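import Mathlib
import Literature.Combinatorics.Sahi2008.ProvedCases

/-!
# Blinovsky (2014): Sahi's `n`-function inequality for cumulations under FKG measures — every `n`,
# with two free slots

CITATION HEADER.  Sources: V. Blinovsky, *Proof of two conjectures on correlation inequalities for one
class of monotone functions*, Probl. Inf. Transm. **50** (2014) 280–284 = arXiv:1306.0862 [Blinovsky2013]
(read 2026-08-19 from the materialised arXiv text, corpus `paper:arxiv-1306.0862`, pp. 1–3); S. Sahi,
*Higher correlation inequalities*, Combinatorica **28** (2008) 209–227 [Sahi2008], Thm. 2 (p. 211),
Prop. 12 (p. 219), Thm. 6 (p. 214); E. H. Lieb, S. Sahi, J. Math. Phys. **63** (2022) [LiebSahi2021],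
Prop. 3.3; C. Fortuin, P. Kasteleyn, J. Ginibre, CMP **22** (1971) [FortuinKasteleynGinibre1971].

## What is proved (everything below is a theorem; no facts, no conjectures)

Blinovsky [Blinovsky2013, eq. (ee3), p. 1]: "Now we prove inequalities (ee3) without assuming that `μ` is
a product measure, i.e., for an arbitrary probability measure that satisfies the FKG condition" — for
`f_1,…,f_n` "linear combinations of unimodal Boolean monotone nondecreasing functions" with nonnegative
coefficients, i.e. Sahi's cumulation cone `𝒞` (nonnegative combinations of indicators of principal
up-sets; the tree's `IsLatticeCumulation`), `E_n(f_1,…,f_n) ≥ 0` — Sahi's Theorem 2 [Sahi2008, Thm. 2]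
with the product measure replaced by an FKG measure.

* `sahiE_nonneg_of_isLatticeCumulation` — the statement above, for every `n`, every FKG probability weight
  on a finite distributive lattice (Lieb–Sahi's "FKG poset"; Blinovsky: `2^[m]`), all slots in `𝒞`.
* `sahiE_nonneg_of_isLatticeCumulation_offTwo` — **the sharper form the proof gives: only `n - 2` of the
  slots need to be cumulations, the remaining two may be arbitrary nonnegative monotone functions.**  At
  `n = 3` this is the tree's `sahiE_three_nonneg_of_monotone_of_isLatticeCumulation` /
  `Literature.Probability.LatticeModels.latticeE3_nonneg_of_principal` (one principal slot); here for all
  `n`.  `cons` form: `sahiE_cons_cons_nonneg_of_isLatticeCumulation`; Boolean-lattice form with the cell's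
  cone `IsCumulation`: `sahi2008_thm2_fkg`.
* `IsFKGMeasure.cond_principalUp` — Blinovsky's Lemma [Blinovsky2013, p. 1] in measure form: conditioning an
  FKG probability weight on a principal up-set of positive mass gives an FKG probability weight.
* `sahiE_cons_principalUp_ge` — the quantitative conditioning inequality behind the induction:
  `E_{k+2}^μ(1_{↑c}, g_0,…,g_k) ≥ μ(↑c)·k·E_{k+1}^{μ(·|↑c)}(g_0,…,g_k)` (Blinovsky's comparison (er9) has
  `μ(A_n)^n` in place of `μ(↑c)`; ours is the `S = univ` term of an exact identity, see below).
* **Cumulation padding is free (relative form, every `K`).**  `sahiE_nonneg_offK_of_condClosed`: for any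
  class of FKG probability weights closed under conditioning on principal up-sets of positive mass, Sahi
  positivity of order `K` on the class (`C_K`) gives `E_n ≥ 0` for EVERY `n` on the class for all nonnegative
  monotone families with at most `K` non-cumulation slots.  Instances: all FKG weights of a lattice
  (`sahiE_nonneg_of_isLatticeCumulation_offK`, `forall_sahiPositive_iff_forall_offK` — the padded hierarchy is
  EQUIVALENT to its level `K`), and all product weights `bernoulliWeight p` on a Boolean lattice `Set ι`
  (`bernoulliWeight_cond_principalUp`: conditioning a product weight on `{ω | c ⊆ ω}` freezes the coordinates
  of `c` to `1`; `sahiE_bernoulliWeight_nonneg_offK`, `forall_sahiPositive_bernoulliWeight_iff_forall_offK`;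
  event forms `sahiE_bernoulliWeight_ind_nonneg_offK` — `K` increasing events padded by cylinder events
  `{ω | S ⊆ ω}` — and, unconditionally at `K = 2`, `sahiE_bernoulliWeight_ind_nonneg_offTwo`,
  `sahiE4_prodBernoulli_nonneg_of_cylinders`), and the ORDER DUAL (decreasing events padded by closed cylinders
  `{ω | ω ⊆ C}`: `bernoulliWeightDual_cond_principalUp`, `sahiE_bernoulliWeightDual_nonneg_offK`,
  `sahiE_bernoulliWeight_ind_nonneg_offK_lower`, unconditional `sahiE_bernoulliWeight_ind_nonneg_offTwo_lower`,
  `sahiE4_prodBernoulli_nonneg_of_subsetCylinders`).  The two-free-slot theorem is the case `K = 2` (`C_2` = FKG).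

## The proof (NOT Blinovsky's; his printed argument is an interpolation `E^k_{n,μ}`, `0 ≤ k ≤ n-1`, between
`E_{n,μ}` and `μ(A_n)^n E_{n,μ_{A_n}}` with the step `I^{k+1} ≥ μ(A_n) I^k` justified by "the FKG
inequality and the induction assumption" and "`B` is the correction term which makes the first equality
valid", written out only for `n = 3` — "the case of an arbitrary `n` is similar to the case of `n = 3`"
[arXiv text p. 2]; it is not transcribable as printed)

1. MARKED SLOT (Sahi's Prop. 12 with slot `0` peeled, the computation inside the tree's `gfE_cons`): for a
   probability weight `ν`, `E_{k+1}^ν(a, g) = Σ_x ν(x)a(x)·[t^{univ}] Z_ν(g)(1 - u_x)⁻¹`,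
   `Z_ν(g) = ∏_x (1-u_x)^{ν(x)}`, `u_x = Σ_i t_i g_i(x)`, in the square-free algebra `ℝ[t_0..t_{k-1}]/(t_i²)`
   (`sahiE_cons_eq_sum`; for `a = 1_A`: `E_{k+1}(1_A, g) = [t^{univ}] Q_{ν,A}(g)`,
   `Q_{ν,A}(g) = Z_ν(g) Σ_{x∈A} ν(x)(1-u_x)⁻¹`).
2. CONDITIONING IDENTITY: for `P = ↑c` with `m = μ(P) > 0` and `μ' = μ(·|P)`, Chu–Vandermonde factor by
   factor gives `Z_μ = Z_{μ'}·W`, `W = ∏_x (1-u_x)^{μ(x)-μ'(x)}`, hence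
   `Q_{μ,P}(g) = m · Q_{μ',univ}(g) · W` and `E_{k+1}^μ(1_P, g) = m Σ_S [t^S]Q_{μ',univ}(g)·[t^{Sᶜ}]W`
   (`sahiE_cons_setInd_decomp`).
3. `W ≥ 0` COEFFICIENTWISE (`coeff_changeWeight_nonneg`): with the Euler derivation `D(t^τ) = |τ|t^τ`,
   `D W = W·V`, `V = Σ_x (μ'(x)-μ(x))·Σ_{j≥1} u_x^j`, and `[t^ρ]V = |ρ|!·Σ_x (μ'(x)-μ(x))∏_{i∈ρ} g_i(x) ≥ 0`
   is the FKG inequality for the increasing function `∏_{i∈ρ} g_i` and the up-set `P`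
   (`sum_cond_sub_mul_prod_nonneg`); a solution of `D W = W V` with `V ≥ 0`, `V_∅ = 0`, `W_∅ ≥ 0` has
   nonnegative coefficients degree by degree (`coeff_nonneg_of_D_eq_mul`).
4. `[t^S]Q_{μ',univ}(g) = [t^{univ}]Q_{μ',univ}(g|_S) = E_{|S|+1}^{μ'}(1, g|_S) = (|S|-1)·E_{|S|}^{μ'}(g|_S)`
   (restriction homomorphism `SqFree.res`, `res_qMark`; branching [Sahi2008, Thm. 6]) — nonnegative by
   induction on the number of functions, since `μ'` is again FKG (Blinovsky's Lemma) and `g|_S` again has at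
   most two non-cumulation slots; cumulation slots are linearised into principal indicators by
   multilinearity, a principal slot is moved to slot `0` by symmetry (`sahiE_comp_perm`); base `n ≤ 2` = FKG.
Only the PEELED slots need to be principal, whence the two free slots.

## Infrastructure note

The square-free algebra `SqFree` and its API (`coeff_mul`, `binomB_mul_binomB_same`, `D_binomB`,
`prod_binomB_add_sqzero`, …) are file-private in `Sahi2008/CumulationCone.lean`; they are accessed here with
`open private … from` (as in `Literature/RepresentationTheory/HeisenbergGroup/SymplecticSiegelGeneration.lean`)
rather than duplicated.  New here: the restriction homomorphism `SqFree.res` along `Fin k ↪ Fin m`, the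
coefficients of powers of the linear form (`coeff_lin_pow`, `coeff_inv1_lin`), and the positivity lemma for
`D W = W V`.
-/

set_option autoImplicit false

open Finset

open private coeff_mul coeff_one coeff_single coeff_C_mul coeff_sum coeff_C coeff_D coeff_add coeff_sub
  D_prod D_binomB D_lin binomB_sub_one mul_inv1 binomB_mul_binomB_same binomB_zero_right
  prod_binomB_add_sqzero lin_cons emb_binomB emb_inv1 coeff_univ_single_zero_mul_emb coeff_emb_univ
  C_mul_single isNil_lin isNil_single single_mul_single_self rch_zero
  IsNil.emb IsNil.pow_eq_zero_of_lt IsNil.neg IsNil.coeff_pow_empty IsNil.mul_left coeff_empty_binomB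
  from Literature.Combinatorics.Sahi2008.CumulationCone

namespace Literature.Combinatorics.Sahi2008

namespace SqFree

variable {R : Type*} [CommRing R]

section Res

variable {k m : ℕ}

/-- The image of a set difference under an embedding. [folklore] -/
private theorem map_sdiff_eq (e : Fin k ↪ Fin m) (τ σ : Finset (Fin k)) :
    (τ \ σ).map e = τ.map e \ σ.map e := by
  ext j
  simp only [Finset.mem_map, Finset.mem_sdiff]
  constructor
  · rintro ⟨i, ⟨hiτ, hiσ⟩, rfl⟩
    refine ⟨⟨i, hiτ, rfl⟩, ?_⟩
    rintro ⟨i', hi'σ, h⟩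
    exact hiσ (e.injective h ▸ hi'σ)
  · rintro ⟨⟨i, hiτ, rfl⟩, h2⟩
    exact ⟨i, ⟨hiτ, fun hiσ => h2 ⟨i, hiσ, rfl⟩⟩, rfl⟩

/-- **Restriction to a subset of the variables** along an embedding `e : Fin k ↪ Fin m`: the coefficient of
`t^τ` of the restriction is the coefficient of `t^{e(τ)}` (the quotient map killing the variables outside the
range of `e`; a ring homomorphism). [folklore] -/
private def res (e : Fin k ↪ Fin m) : SqFree (Fin m) R →+* SqFree (Fin k) R where
  toFun a := ⟨fun τ => a.coeff (τ.map e)⟩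
  map_one' := by
    ext τ
    show (1 : SqFree (Fin m) R).coeff (τ.map e) = (1 : SqFree (Fin k) R).coeff τ
    rw [coeff_one, coeff_one]
    simp only [Finset.map_eq_empty]
  map_mul' a b := by
    ext τ
    show (a * b).coeff (τ.map e) =
      (SqFree.mk (fun τ => a.coeff (τ.map e)) * SqFree.mk (fun τ => b.coeff (τ.map e))).coeff τ
    rw [coeff_mul, coeff_mul]
    symm
    refine Finset.sum_nbij' (fun σ => σ.map e) (fun σ' => τ.filter (fun i => e i ∈ σ')) ?_ ?_ ?_ ?_ ?_
    · intro σ hσ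
      exact mem_powerset.2 (Finset.map_subset_map.2 (mem_powerset.1 hσ))
    · intro σ' _
      exact mem_powerset.2 (Finset.filter_subset _ _)
    · intro σ hσ
      ext i
      simp only [Finset.mem_filter, Finset.mem_map']
      exact ⟨fun h => h.2, fun hi => ⟨mem_powerset.1 hσ hi, hi⟩⟩
    · intro σ' hσ'
      ext j
      simp only [Finset.mem_map, Finset.mem_filter]
      constructor
      · rintro ⟨i, ⟨_, hi⟩, rfl⟩
        exact hi
      · intro hj
        obtain ⟨i, hiτ, rfl⟩ := Finset.mem_map.1 (mem_powerset.1 hσ' hj)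
        exact ⟨i, ⟨hiτ, hj⟩, rfl⟩
    · intro σ _
      show a.coeff (σ.map e) * b.coeff ((τ \ σ).map e) = a.coeff (σ.map e) * b.coeff (τ.map e \ σ.map e)
      rw [map_sdiff_eq]
  map_zero' := by ext τ; rfl
  map_add' a b := by ext τ; rfl

/-- Coefficients of a restriction. [folklore] -/
private theorem coeff_res (e : Fin k ↪ Fin m) (a : SqFree (Fin m) R) (τ : Finset (Fin k)) :
    (res e a).coeff τ = a.coeff (τ.map e) := rfl

/-- Restriction fixes constants. [folklore] -/
private theorem res_C (e : Fin k ↪ Fin m) (r : R) : res e (C r : SqFree (Fin m) R) = C r := by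
  ext τ
  rw [coeff_res, coeff_C, coeff_C]
  simp only [Finset.map_eq_empty]

/-- Restriction of a monomial in the range. [folklore] -/
private theorem res_single_map (e : Fin k ↪ Fin m) (σ : Finset (Fin k)) (r : R) :
    res e (single (σ.map e) r) = single σ r := by
  ext τ
  rw [coeff_res, coeff_single, coeff_single]
  simp only [Finset.map_inj]

/-- Restriction kills a variable outside the range. [folklore] -/
private theorem res_single_singleton_of_notMem (e : Fin k ↪ Fin m) {j : Fin m} (hj : j ∉ Set.range e)
    (r : R) : res e (single {j} r) = 0 := by
  ext τ
  rw [coeff_res, coeff_single]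
  show (if τ.map e = {j} then r else 0) = 0
  rw [if_neg]
  intro h
  have : j ∈ τ.map e := by rw [h]; exact Finset.mem_singleton_self j
  obtain ⟨i, _, hi⟩ := Finset.mem_map.1 this
  exact hj ⟨i, hi⟩

/-- Restriction preserves having no constant term. [folklore] -/
private theorem isNil_res (e : Fin k ↪ Fin m) {a : SqFree (Fin m) R} (ha : a.IsNil) : (res e a).IsNil := by
  unfold IsNil at *
  rw [coeff_res, Finset.map_empty, ha]

/-- `k ≤ m` when `Fin k` embeds in `Fin m`. [folklore] -/
private theorem le_of_emb (e : Fin k ↪ Fin m) : k ≤ m := by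
  simpa using Fintype.card_le_of_embedding e

/-- Restriction commutes with `(1-u)⁻¹`. [folklore] -/
private theorem res_inv1 (e : Fin k ↪ Fin m) {u : SqFree (Fin m) R} (hu : u.IsNil) :
    res e (inv1 u) = inv1 (res e u) := by
  have hk := le_of_emb e
  rw [inv1, inv1, map_sum, Fintype.card_fin, Fintype.card_fin]
  simp only [map_pow]
  symm
  have hsub : Finset.range (k + 1) ⊆ Finset.range (m + 1) := Finset.range_subset_range.2 (by omega)
  refine Finset.sum_subset hsub fun j hj hj' => ?_
  rw [Finset.mem_range] at hj hj'
  have hlt : Fintype.card (Fin k) < j := by rw [Fintype.card_fin]; omega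
  exact IsNil.pow_eq_zero_of_lt (isNil_res e hu) hlt

variable [Algebra ℚ R]

/-- Restriction commutes with binomial powers. [folklore] -/
private theorem res_binomB (e : Fin k ↪ Fin m) {u : SqFree (Fin m) R} (hu : u.IsNil) (c : R) :
    res e (binomB c u) = binomB c (res e u) := by
  have hk := le_of_emb e
  rw [binomB, binomB, map_sum, Fintype.card_fin, Fintype.card_fin]
  simp only [map_mul, res_C, map_pow, map_neg]
  symm
  have hsub : Finset.range (k + 1) ⊆ Finset.range (m + 1) := Finset.range_subset_range.2 (by omega)
  refine Finset.sum_subset hsub fun j hj hj' => ?_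
  rw [Finset.mem_range] at hj hj'
  have hlt : Fintype.card (Fin k) < j := by rw [Fintype.card_fin]; omega
  rw [IsNil.pow_eq_zero_of_lt (IsNil.neg (isNil_res e hu)) hlt, mul_zero]

omit [Algebra ℚ R] in
/-- Restriction of the linear form `Σ_i t_i g_i(x)` is the linear form of the sub-family. [folklore] -/
private theorem res_lin {α : Type*} (e : Fin k ↪ Fin m) (g : Fin m → α → R) (x : α) :
    res e (lin g x) = lin (fun i => g (e i)) x := by
  rw [lin, lin, map_sum]
  have h1 : ∀ i : Fin k, single {i} (g (e i) x) = res e (single {e i} (g (e i) x)) := by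
    intro i
    rw [← Finset.map_singleton e, res_single_map]
  simp_rw [h1]
  rw [← Finset.sum_map univ e (fun j => res e (single {j} (g j x)))]
  refine (Finset.sum_subset (Finset.subset_univ _) fun j _ hj => ?_).symm
  exact res_single_singleton_of_notMem e
    (fun ⟨i, hi⟩ => hj (Finset.mem_map.2 ⟨i, Finset.mem_univ i, hi⟩)) _

end Res

section LinPow

variable {α : Type*}

/-- Coefficients of the linear form `Σ_i t_i g_i(x)`. [folklore] -/
private theorem coeff_lin {n : ℕ} (g : Fin n → α → R) (x : α) (ρ : Finset (Fin n)) :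
    (lin g x).coeff ρ = ∑ i, if ρ = {i} then g i x else 0 := by
  rw [lin, coeff_sum]
  exact Finset.sum_congr rfl fun i _ => by rw [coeff_single]

/-- **Coefficients of the powers of the linear form**: `(Σ_i t_i a_i)^j = j! Σ_{|ρ| = j} (∏_{i∈ρ} a_i) t^ρ`
in the square-free algebra. [folklore] -/
private theorem coeff_lin_pow {n : ℕ} (g : Fin n → α → R) (x : α) :
    ∀ (j : ℕ) (ρ : Finset (Fin n)),
      ((lin g x) ^ j).coeff ρ = if ρ.card = j then (j.factorial : R) * ∏ i ∈ ρ, g i x else 0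
  | 0, ρ => by
      rw [pow_zero, coeff_one, Nat.factorial_zero, Nat.cast_one, one_mul]
      by_cases h : ρ = ∅
      · subst h
        simp
      · have hc : ρ.card ≠ 0 := by rwa [Ne, Finset.card_eq_zero]
        rw [if_neg h, if_neg hc]
  | j + 1, ρ => by
      rw [pow_succ', coeff_mul]
      have h1 : ∀ σ ∈ ρ.powerset, (lin g x).coeff σ * ((lin g x) ^ j).coeff (ρ \ σ)
          = ∑ i, if σ = {i} then g i x * ((lin g x) ^ j).coeff (ρ \ {i}) else 0 := by
        intro σ _
        rw [coeff_lin, Finset.sum_mul]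
        refine Finset.sum_congr rfl fun i _ => ?_
        split_ifs with h
        · rw [h]
        · rw [zero_mul]
      rw [Finset.sum_congr rfl h1, Finset.sum_comm]
      have h2 : ∀ i ∈ (univ : Finset (Fin n)),
          (∑ σ ∈ ρ.powerset, if σ = {i} then g i x * ((lin g x) ^ j).coeff (ρ \ {i}) else 0)
            = if i ∈ ρ then g i x * ((lin g x) ^ j).coeff (ρ.erase i) else 0 := by
        intro i _
        rw [Finset.sum_ite_eq' ρ.powerset {i}]
        simp only [Finset.mem_powerset, Finset.singleton_subset_iff, Finset.sdiff_singleton_eq_erase]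
      rw [Finset.sum_congr rfl h2, ← Finset.sum_filter, Finset.filter_mem_eq_inter, Finset.univ_inter]
      have h3 : ∀ i ∈ ρ, g i x * ((lin g x) ^ j).coeff (ρ.erase i)
          = if ρ.card = j + 1 then (j.factorial : R) * ∏ l ∈ ρ, g l x else 0 := by
        intro i hi
        rw [coeff_lin_pow g x j (ρ.erase i), Finset.card_erase_of_mem hi]
        have hc : 0 < ρ.card := Finset.card_pos.2 ⟨i, hi⟩
        by_cases h : ρ.card = j + 1
        · rw [if_pos (by omega), if_pos h, mul_left_comm, Finset.mul_prod_erase ρ (fun l => g l x) hi]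
        · rw [if_neg (by omega), if_neg h, mul_zero]
      rw [Finset.sum_congr rfl h3, Finset.sum_const, nsmul_eq_mul]
      split_ifs with h
      · rw [h, Nat.factorial_succ]; push_cast; ring
      · rw [mul_zero]

/-- **Coefficients of `(1 - Σ_i t_i a_i)⁻¹`**: the coefficient of `t^ρ` is `|ρ|! ∏_{i∈ρ} a_i`.
[folklore] -/
private theorem coeff_inv1_lin {n : ℕ} (g : Fin n → α → R) (x : α) (ρ : Finset (Fin n)) :
    (inv1 (lin g x)).coeff ρ = (ρ.card.factorial : R) * ∏ i ∈ ρ, g i x := by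
  rw [inv1, coeff_sum]
  simp_rw [coeff_lin_pow]
  rw [Finset.sum_ite_eq, if_pos]
  rw [Finset.mem_range, Fintype.card_fin]
  exact Nat.lt_succ_of_le (ρ.card_le_univ.trans (by rw [Fintype.card_fin]))

end LinPow

section Positivity

variable {κ : Type*} [DecidableEq κ]

/-- Constant term of a product of two elements. [folklore] -/
private theorem coeff_empty_mul (a b : SqFree κ R) : (a * b).coeff ∅ = a.coeff ∅ * b.coeff ∅ := by
  rw [coeff_mul, Finset.powerset_empty, Finset.sum_singleton, sdiff_self, Finset.bot_eq_empty]

/-- Constant term of a finite product. [folklore] -/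
private theorem coeff_empty_prod {β : Type*} (s : Finset β) (f : β → SqFree κ R) :
    (∏ x ∈ s, f x).coeff ∅ = ∏ x ∈ s, (f x).coeff ∅ := by
  induction s using Finset.cons_induction with
  | empty => rw [Finset.prod_empty, Finset.prod_empty, coeff_one, if_pos rfl]
  | cons x s hx ih => rw [Finset.prod_cons, Finset.prod_cons, coeff_empty_mul, ih]

/-- **Positivity from a derivation equation.**  If `D W = W·V` where `V` has nonnegative coefficients and no
constant term, and the constant term of `W` is nonnegative, then every coefficient of `W` is nonnegative (the
Euler derivation `D` multiplies the coefficient of `t^τ` by `|τ|`, so the equation determines the coefficients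
of `W` degree by degree as nonnegative combinations of lower ones). [folklore] -/
private theorem coeff_nonneg_of_D_eq_mul {W V : SqFree κ ℝ} (hD : D W = W * V) (hV0 : V.coeff ∅ = 0)
    (hV : ∀ ρ, 0 ≤ V.coeff ρ) (hW0 : 0 ≤ W.coeff ∅) : ∀ τ, 0 ≤ W.coeff τ := by
  intro τ
  induction' hN : τ.card using Nat.strong_induction_on with N ih generalizing τ
  rcases Nat.eq_zero_or_pos N with h0 | hpos
  · subst h0
    rw [Finset.card_eq_zero] at hN
    rw [hN]
    exact hW0
  · have key : (τ.card : ℝ) * W.coeff τ = ∑ σ ∈ τ.powerset, W.coeff σ * V.coeff (τ \ σ) := by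
      have h := congrArg (fun z => z.coeff τ) hD
      simp only [coeff_D] at h
      rw [h, coeff_mul]
    have hsum : 0 ≤ ∑ σ ∈ τ.powerset, W.coeff σ * V.coeff (τ \ σ) := by
      refine Finset.sum_nonneg fun σ hσ => ?_
      by_cases hστ : σ = τ
      · rw [hστ, sdiff_self, Finset.bot_eq_empty, hV0, mul_zero]
      · have hlt : σ.card < N := by
          rw [← hN]
          exact Finset.card_lt_card ((Finset.mem_powerset.1 hσ).ssubset_of_ne hστ)
        exact mul_nonneg (ih σ.card hlt σ rfl) (hV _)
    rw [← key, hN] at hsum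
    have hNpos : (0 : ℝ) < N := by exact_mod_cast hpos
    exact (mul_nonneg_iff_of_pos_left hNpos).1 hsum

end Positivity

end SqFree

/-! ## The marked-slot generating function and the conditioning identity -/

section GF

open SqFree

variable {α : Type*} [Fintype α]

/-- `Z_ν(g) = ∏_x (1 - Σ_i t_i g_i(x))^{ν(x)}`, the square-free generating product of a family `g` under the
weight `ν` (as in Sahi's Proposition 12). [cite: Sahi2008, Prop. 12 (p. 219), eq. (14)] -/
private noncomputable def zProd (ν : α → ℝ) {k : ℕ} (g : Fin k → α → ℝ) : SqFree (Fin k) ℝ :=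
  ∏ x, binomB (ν x) (lin g x)

/-- `Q_{ν,A}(g) = Z_ν(g) · Σ_{x∈A} ν(x) (1 - Σ_i t_i g_i(x))⁻¹`: the `t_0`-coefficient of the generating product
of the marked family `(1_A, g)` (see `sahiE_cons_setInd_eq`). [cite: Sahi2008, Prop. 12 (p. 219)] -/
private noncomputable def qMark (ν : α → ℝ) (A : Finset α) {k : ℕ} (g : Fin k → α → ℝ) :
    SqFree (Fin k) ℝ :=
  zProd ν g * ∑ x ∈ A, C (ν x) * inv1 (lin g x)

/-- **The marked-slot formula** (peeling slot `0` in Proposition 12): for a probability weight `ν`,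
`E_{k+1}(a, g_0,…,g_{k-1}) = Σ_x ν(x) a(x) · [t_0⋯t_{k-1}] (Z_ν(g) (1 - Σ_i t_i g_i(x))⁻¹)`.
[cite: Sahi2008, Prop. 12 (p. 219); LiebSahi2021, Prop. 3.3] -/
private theorem sahiE_cons_eq_sum (ν : α → ℝ) (hν : ∑ x, ν x = 1) {k : ℕ} (a : α → ℝ)
    (g : Fin k → α → ℝ) :
    sahiE ν (k + 1) (Matrix.vecCons a g) =
      ∑ x, ν x * a x * (zProd ν g * inv1 (lin g x)).coeff univ := by
  classical
  cases k with
  | zero =>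
    have hlin : ∀ x, lin g x = 0 := fun x => by simp [lin]
    have hZ : zProd ν g = 1 :=
      Finset.prod_eq_one fun x _ => by rw [hlin, binomB_zero_right]
    have hI : ∀ x, inv1 (lin g x) = 1 := fun x => by
      rw [hlin, inv1, Fintype.card_fin, Finset.sum_range_one, pow_zero]
    have hu : (univ : Finset (Fin 0)) = ∅ := Finset.univ_eq_empty
    simp only [hZ, hI, mul_one, hu, coeff_one, if_true]
    show sahiE ν 1 (Matrix.vecCons a g) = _
    rw [sahiE_one_apply, Matrix.cons_val_zero]
    rfl
  | succ n =>
    set u : α → SqFree (Fin (n + 1)) ℝ := fun x => lin g x with hu_def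
    have hu : ∀ x, (u x).IsNil := fun x => isNil_lin g x
    set Z : SqFree (Fin (n + 1)) ℝ := ∏ x, binomB (ν x) (u x) with hZ_def
    have hZ : zProd ν g = Z := rfl
    rw [sahiE_eq_gfE ν hν, hZ]
    have hl : ∀ x ∈ (univ : Finset α),
        binomB (ν x) (lin (Matrix.vecCons a g) x) = binomB (ν x) (emb (u x) + single {0} (a x)) := by
      intro x _
      rw [lin_cons]
      congr 1
      exact add_comm _ _
    have hP : ∏ x, binomB (ν x) (emb (u x)) = emb Z := by
      rw [hZ_def, map_prod]
      exact Finset.prod_congr rfl fun x _ => (emb_binomB (hu x) (ν x)).symm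
    rw [gfE, Finset.prod_congr rfl hl,
      prod_binomB_add_sqzero univ ν (fun x => emb (u x)) (fun x => single {0} (a x))
        (fun x => IsNil.emb (hu x)) (fun x => isNil_single (singleton_nonempty _) _)
        (fun x y => single_mul_single_self (singleton_nonempty _) _ _), hP]
    have : (1 : SqFree (Fin (n + 2)) ℝ) -
        emb Z * (1 - ∑ x, C (ν x) * single {0} (a x) * inv1 (emb (u x)))
        = (1 - emb Z) + ∑ x, emb Z * (C (ν x) * single {0} (a x) * inv1 (emb (u x))) := by
      rw [mul_sub, mul_one, Finset.mul_sum]; ring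
    rw [this, coeff_add, coeff_sub, coeff_one, if_neg (Finset.univ_nonempty.ne_empty), coeff_emb_univ,
      sub_zero, zero_add, coeff_sum]
    refine Finset.sum_congr rfl fun x _ => ?_
    rw [← emb_inv1 (hu x), C_mul_single]
    have : emb Z * (single {0} (ν x * a x) * emb (inv1 (u x)))
        = single {0} (ν x * a x) * emb (Z * inv1 (u x)) := by
      rw [map_mul]; ring
    rw [this, coeff_univ_single_zero_mul_emb]

/-- The marked-slot formula for an indicator in slot `0`: `E_{k+1}(1_A, g) = [t_0⋯t_{k-1}] Q_{ν,A}(g)`.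
[cite: Sahi2008, Prop. 12 (p. 219)] -/
private theorem sahiE_cons_setInd_eq [DecidableEq α] (ν : α → ℝ) (hν : ∑ x, ν x = 1) {k : ℕ}
    (A : Finset α) (g : Fin k → α → ℝ) :
    sahiE ν (k + 1) (Matrix.vecCons (setInd A) g) = (qMark ν A g).coeff univ := by
  rw [sahiE_cons_eq_sum ν hν, qMark, Finset.mul_sum, coeff_sum]
  have h : ∀ x ∈ A, (zProd ν g * (C (ν x) * inv1 (lin g x))).coeff univ
      = ν x * (zProd ν g * inv1 (lin g x)).coeff univ := by
    intro x _
    rw [mul_left_comm, coeff_C_mul]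
  rw [Finset.sum_congr rfl h]
  simp only [setInd_apply, mul_ite, mul_one, mul_zero, ite_mul, zero_mul]
  rw [Finset.sum_ite_mem, Finset.univ_inter]

/-- The marked-slot formula for the constant `1` in slot `0`: `E_{k+1}(1, g) = [t_0⋯t_{k-1}] Q_{ν,univ}(g)`.
[cite: Sahi2008, Prop. 12 (p. 219); Thm. 6 (p. 214)] -/
private theorem sahiE_cons_one_eq (ν : α → ℝ) (hν : ∑ x, ν x = 1) {k : ℕ} (g : Fin k → α → ℝ) :
    sahiE ν (k + 1) (Matrix.vecCons 1 g) = (qMark ν univ g).coeff univ := by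
  rw [sahiE_cons_eq_sum ν hν, qMark, Finset.mul_sum, coeff_sum]
  refine Finset.sum_congr rfl fun x _ => ?_
  rw [Pi.one_apply, mul_one, mul_left_comm, coeff_C_mul]

/-- Restriction of the generating product to a sub-family. [folklore] -/
private theorem res_zProd {j k : ℕ} (e : Fin j ↪ Fin k) (ν : α → ℝ) (g : Fin k → α → ℝ) :
    res e (zProd ν g) = zProd ν (fun i => g (e i)) := by
  rw [zProd, zProd, map_prod]
  exact Finset.prod_congr rfl fun x _ => by rw [res_binomB e (isNil_lin g x), res_lin]

/-- Restriction of the marked generating function to a sub-family: the coefficient of `t^S` of `Q(g)` is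
the top coefficient of `Q(g|_S)`. [folklore] -/
private theorem res_qMark {j k : ℕ} (e : Fin j ↪ Fin k) (ν : α → ℝ) (A : Finset α)
    (g : Fin k → α → ℝ) : res e (qMark ν A g) = qMark ν A (fun i => g (e i)) := by
  rw [qMark, qMark, map_mul, res_zProd, map_sum]
  congr 1
  exact Finset.sum_congr rfl fun x _ => by rw [map_mul, res_C, res_inv1 e (isNil_lin g x), res_lin]

/-- **Change of weight** in the generating product: `Z_μ(g) = Z_{μ'}(g) · ∏_x (1 - Σ t_i g_i(x))^{μ(x)-μ'(x)}`
(Chu–Vandermonde factor by factor). [folklore] -/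
private theorem zProd_eq_mul (μ μ' : α → ℝ) {k : ℕ} (g : Fin k → α → ℝ) :
    zProd μ g = zProd μ' g * ∏ x, binomB (μ x - μ' x) (lin g x) := by
  rw [zProd, zProd, ← Finset.prod_mul_distrib]
  refine Finset.prod_congr rfl fun x _ => ?_
  rw [binomB_mul_binomB_same (isNil_lin g x)]
  congr 1
  ring

/-- **The conditioning identity, algebraic form.**  If `m·μ' = μ·1_P` (so `μ' = μ(· | P)` when `m = μ(P) ≠ 0`),
then `Q_{μ,P}(g) = m · Q_{μ',univ}(g) · ∏_x (1 - Σ t_i g_i(x))^{μ(x)-μ'(x)}`. [folklore] -/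
private theorem qMark_eq_of_cond [DecidableEq α] (μ μ' : α → ℝ) (P : Finset α) (m : ℝ)
    (hμ' : ∀ x, m * μ' x = if x ∈ P then μ x else 0) {k : ℕ} (g : Fin k → α → ℝ) :
    qMark μ P g = C m * (qMark μ' univ g * ∏ x, binomB (μ x - μ' x) (lin g x)) := by
  have hsum : ∑ x ∈ P, C (μ x) * inv1 (lin g x)
      = C m * ∑ x, C (μ' x) * inv1 (lin g x) := by
    rw [Finset.mul_sum]
    have h : ∀ x ∈ (univ : Finset α), C m * (C (μ' x) * inv1 (lin g x))
        = if x ∈ P then C (μ x) * inv1 (lin g x) else 0 := by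
      intro x _
      rw [← mul_assoc, ← map_mul, hμ' x]
      split_ifs
      · rfl
      · rw [map_zero, zero_mul]
    rw [Finset.sum_congr rfl h, Finset.sum_ite_mem, Finset.univ_inter]
  rw [qMark, qMark, hsum, zProd_eq_mul μ μ' g]
  ring

/-- **The conditioning identity for `E_n`.**  With `μ'`, `m`, `P` as in `qMark_eq_of_cond` and `μ` a
probability weight,
`E_{k+1}(1_P, g) = m · Σ_{S} [t^S] Q_{μ',univ}(g) · [t^{Sᶜ}] ∏_x (1 - Σ t_i g_i(x))^{μ(x)-μ'(x)}`.
[folklore] -/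
private theorem sahiE_cons_setInd_decomp [DecidableEq α] (μ : α → ℝ) (hμ1 : ∑ x, μ x = 1)
    (μ' : α → ℝ) (P : Finset α) (m : ℝ) (hμ' : ∀ x, m * μ' x = if x ∈ P then μ x else 0)
    {k : ℕ} (g : Fin k → α → ℝ) :
    sahiE μ (k + 1) (Matrix.vecCons (setInd P) g) =
      m * ∑ S ∈ (univ : Finset (Fin k)).powerset,
        (qMark μ' univ g).coeff S * (∏ x, binomB (μ x - μ' x) (lin g x)).coeff (univ \ S) := by
  rw [sahiE_cons_setInd_eq μ hμ1, qMark_eq_of_cond μ μ' P m hμ' g, coeff_C_mul, coeff_mul]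

/-- **Positivity of the change-of-weight factor.**  If `Σ_x (μ'(x) - μ(x)) ∏_{i∈ρ} g_i(x) ≥ 0` for every
`ρ` (for `μ' = μ(· | P)`, `P` an up-set and `g_i ≥ 0` monotone this is the FKG inequality), then every
coefficient of `W = ∏_x (1 - Σ t_i g_i(x))^{μ(x)-μ'(x)}` is nonnegative: `D W = W · V` with
`V = Σ_x (μ'(x)-μ(x)) Σ_{j≥1} (Σ t_i g_i(x))^j ≥ 0`. [folklore] -/
private theorem coeff_changeWeight_nonneg (μ μ' : α → ℝ) {k : ℕ} (g : Fin k → α → ℝ)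
    (H : ∀ ρ : Finset (Fin k), 0 ≤ ∑ x, (μ' x - μ x) * ∏ i ∈ ρ, g i x) :
    ∀ τ, 0 ≤ (∏ x, binomB (μ x - μ' x) (lin g x)).coeff τ := by
  classical
  set u : α → SqFree (Fin k) ℝ := fun x => lin g x with hu_def
  have hu : ∀ x, (u x).IsNil := fun x => isNil_lin g x
  set W : SqFree (Fin k) ℝ := ∏ x, binomB (μ x - μ' x) (u x) with hW_def
  set V : SqFree (Fin k) ℝ := ∑ x, C (μ' x - μ x) * (u x * inv1 (u x)) with hV_def
  have hD : D W = W * V := by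
    rw [hW_def, D_prod]
    have ht : ∀ x ∈ (univ : Finset α),
        (∏ y ∈ univ.erase x, binomB (μ y - μ' y) (u y)) * D (binomB (μ x - μ' x) (u x))
          = W * (C (μ' x - μ x) * (u x * inv1 (u x))) := by
      intro x _
      rw [D_binomB (hu x), hu_def, D_lin, binomB_sub_one (hu x)]
      have : (∏ y ∈ univ.erase x, binomB (μ y - μ' y) (lin g y)) *
          -(C (μ x - μ' x) * lin g x * (binomB (μ x - μ' x) (lin g x) * inv1 (lin g x)))
          = -(C (μ x - μ' x) * (lin g x * inv1 (lin g x)) *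
              ((∏ y ∈ univ.erase x, binomB (μ y - μ' y) (lin g y)) * binomB (μ x - μ' x) (lin g x))) := by
        ring
      rw [this, Finset.prod_erase_mul _ _ (mem_univ x), hW_def, hu_def]
      have hC : (C (μ' x - μ x) : SqFree (Fin k) ℝ) = -C (μ x - μ' x) := by
        rw [← map_neg]; congr 1; ring
      rw [hC]
      ring
    rw [Finset.sum_congr rfl ht, ← Finset.mul_sum]
  have hVcoeff : ∀ ρ, V.coeff ρ =
      ∑ x, (μ' x - μ x) * ((ρ.card.factorial : ℝ) * ∏ i ∈ ρ, g i x - if ρ = ∅ then 1 else 0) := by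
    intro ρ
    rw [hV_def, coeff_sum]
    refine Finset.sum_congr rfl fun x _ => ?_
    rw [coeff_C_mul, mul_inv1 (hu x), coeff_sub, hu_def, coeff_inv1_lin, coeff_one]
  refine coeff_nonneg_of_D_eq_mul hD ?_ ?_ ?_
  · rw [hVcoeff]
    simp
  · intro ρ
    rw [hVcoeff]
    by_cases hρ : ρ = ∅
    · subst hρ; simp
    · simp only [hρ, if_false, sub_zero]
      have : ∑ x, (μ' x - μ x) * ((ρ.card.factorial : ℝ) * ∏ i ∈ ρ, g i x)
          = (ρ.card.factorial : ℝ) * ∑ x, (μ' x - μ x) * ∏ i ∈ ρ, g i x := by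
        rw [Finset.mul_sum]
        exact Finset.sum_congr rfl fun x _ => by ring
      rw [this]
      exact mul_nonneg (Nat.cast_nonneg _) (H ρ)
  · rw [hW_def, coeff_empty_prod]
    refine Finset.prod_nonneg fun x _ => ?_
    rw [coeff_empty_binomB (hu x)]
    exact zero_le_one

end GF

/-! ## Blinovsky's theorem — cumulations under FKG measures, every `n` — with two free slots -/

section Main

open SqFree
open Literature.Probability.LatticeModels (principalUp mem_principalUp isUpperSet_principalUp
  logSupermodular_restrict_principal)

variable {α : Type*} [Fintype α]

/-- The indicator of a principal up-set is a cumulation. [cite: Sahi2008, p. 210 (the class 𝒞[X]);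
Blinovsky2013, p. 1 (unimodal monotone Boolean functions)] -/
theorem isLatticeCumulation_setInd_principalUp [Preorder α] [DecidableEq α] [DecidableLE α] (c : α) :
    IsLatticeCumulation (setInd (principalUp c)) := by
  refine ⟨fun c' => if c' = c then 1 else 0, fun c' => ?_, funext fun x => ?_⟩
  · show (0 : ℝ) ≤ if c' = c then 1 else 0
    split_ifs <;> norm_num
  have h : ∀ c' ∈ (univ : Finset α), (if c' ≤ x then (if c' = c then (1 : ℝ) else 0) else 0)
      = if c' = c then (if c ≤ x then 1 else 0) else 0 := by
    intro c' _
    by_cases hc : c' = c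
    · subst hc
      by_cases hx : c' ≤ x <;> simp [hx]
    · simp [hc]
  show setInd (principalUp c) x = ∑ c', if c' ≤ x then (if c' = c then (1 : ℝ) else 0) else 0
  rw [Finset.sum_congr rfl h, Finset.sum_ite_eq', if_pos (Finset.mem_univ c), setInd_apply]
  simp only [mem_principalUp]

/-- **Blinovsky's Lemma, measure form.**  Conditioning an FKG probability weight on a principal up-set
`{x | c ≤ x}` of positive mass gives again an FKG probability weight (the principal up-set is closed under
`⊓` and `⊔`). [cite: Blinovsky2013, Lemma (arXiv text p. 1)] -/
theorem IsFKGMeasure.cond_principalUp [DistribLattice α] [DecidableLE α] {μ : α → ℝ}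
    (hμ : IsFKGMeasure μ) (c : α) (hm : 0 < ∑ x ∈ principalUp c, μ x) :
    IsFKGMeasure (fun x => (if c ≤ x then μ x else 0) / ∑ x ∈ principalUp c, μ x) where
  nonneg x := div_nonneg (by split_ifs; exacts [hμ.nonneg x, le_rfl]) hm.le
  sum_eq_one := by
    rw [← Finset.sum_div, ← Finset.sum_filter]
    exact div_self hm.ne'
  mul_le_mul a b := by
    rw [div_mul_div_comm, div_mul_div_comm]
    exact div_le_div_of_nonneg_right
      (logSupermodular_restrict_principal (fun x => hμ.nonneg x) hμ.mul_le_mul c a b)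
      (mul_nonneg hm.le hm.le)

/-- The FKG input of the conditioning step: for `μ' = μ(· | c ≤ ·)`, monotone nonnegative `g_i` and any
`ρ`, `Σ_x μ(x) ∏_{i∈ρ} g_i(x) ≤ Σ_x μ'(x) ∏_{i∈ρ} g_i(x)` (positive correlation of the increasing function
`∏_{i∈ρ} g_i` with the up-set `{c ≤ ·}`). [cite: Blinovsky2013, Lemma (arXiv text p. 1);
FortuinKasteleynGinibre1971, Thm. (Prop. 1)] -/
private theorem sum_cond_sub_mul_prod_nonneg [DistribLattice α] [DecidableEq α] [DecidableLE α]
    {μ : α → ℝ} (hμ : IsFKGMeasure μ) (c : α) (hm : 0 < ∑ x ∈ principalUp c, μ x) {k : ℕ}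
    {g : Fin k → α → ℝ} (hg0 : ∀ i x, 0 ≤ g i x) (hgm : ∀ i, Monotone (g i)) (ρ : Finset (Fin k)) :
    0 ≤ ∑ x, ((if c ≤ x then μ x else 0) / (∑ x ∈ principalUp c, μ x) - μ x) * ∏ i ∈ ρ, g i x := by
  set m := ∑ x ∈ principalUp c, μ x with hm_def
  have hP0 : ∀ x, 0 ≤ ∏ i ∈ ρ, g i x := fun x => Finset.prod_nonneg fun i _ => hg0 i x
  have hPm : Monotone (fun x => ∏ i ∈ ρ, g i x) := fun x y hxy =>
    Finset.prod_le_prod (fun i _ => hg0 i x) (fun i _ => hgm i hxy)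
  have hfkg := ex_mul_ex_le_ex_mul hμ hP0 (setInd_nonneg (principalUp c)) hPm
    (monotone_setInd (isUpperSet_principalUp c))
  have h1 : ex μ (setInd (principalUp c)) = m := by
    rw [ex_setInd]; rfl
  have h2 : ex μ ((fun x => ∏ i ∈ ρ, g i x) * setInd (principalUp c))
      = m * ∑ x, (if c ≤ x then μ x else 0) / m * ∏ i ∈ ρ, g i x := by
    rw [ex, Finset.mul_sum]
    refine Finset.sum_congr rfl fun x _ => ?_
    simp only [Pi.mul_apply, setInd_apply, mem_principalUp]
    by_cases hx : c ≤ x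
    · rw [if_pos hx, if_pos hx, mul_one, ← mul_assoc, mul_div_cancel₀ _ hm.ne']
    · rw [if_neg hx, if_neg hx, mul_zero, mul_zero, zero_div, zero_mul, mul_zero]
  rw [h1, h2] at hfkg
  have h3 : ex μ (fun x => ∏ i ∈ ρ, g i x) ≤ ∑ x, (if c ≤ x then μ x else 0) / m * ∏ i ∈ ρ, g i x := by
    rw [mul_comm m] at hfkg
    exact le_of_mul_le_mul_right hfkg hm
  have h4 : ∑ x, ((if c ≤ x then μ x else 0) / m - μ x) * ∏ i ∈ ρ, g i x
      = (∑ x, (if c ≤ x then μ x else 0) / m * ∏ i ∈ ρ, g i x) - ex μ (fun x => ∏ i ∈ ρ, g i x) := by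
    rw [ex, ← Finset.sum_sub_distrib]
    exact Finset.sum_congr rfl fun x _ => by ring
  rw [h4]
  exact sub_nonneg.2 h3

/-- The image of `univ` under the increasing enumeration of a finite set of indices is the set. [folklore] -/
private theorem map_univ_orderEmbOfFin {k : ℕ} (S : Finset (Fin k)) {j : ℕ} (hj : S.card = j) :
    (univ : Finset (Fin j)).map (S.orderEmbOfFin hj).toEmbedding = S := by
  ext x
  simp only [Finset.mem_map, Finset.mem_univ, true_and]
  constructor
  · rintro ⟨i, rfl⟩
    exact S.orderEmbOfFin_mem hj i
  · intro hx
    have hx' : x ∈ Set.range (S.orderEmbOfFin hj) := by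
      rw [Finset.range_orderEmbOfFin]; exact hx
    obtain ⟨i, hi⟩ := hx'
    exact ⟨i, hi⟩

/-- **The induction step at a principal slot.**  Work inside a class `Cl` of FKG probability weights closed
under conditioning on principal up-sets of positive mass (`hFKG`, `hcond`; e.g. all FKG weights, by
Blinovsky's Lemma, or all product weights).  Assuming the theorem below for all families of at most `k`
functions under weights of the class (hypothesis `ih`), `E_{k+1}(1_{↑c}, g_0,…,g_{k-1}) ≥ 0` for a weight `μ`
of the class and a family `g` of nonnegative monotone functions all but at most `K` of which are cumulations:
by the conditioning identity `E_{k+1}(1_{↑c}, g) = μ(↑c) Σ_S E^{μ(·|↑c)}_{|S|+1}(1, g_S)·W_{Sᶜ}` with `W ≥ 0`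
(`coeff_changeWeight_nonneg`) and `E_{|S|+1}(1, g_S) = (|S|-1)E_{|S|}(g_S) ≥ 0` by branching and `ih`.
[cite: Blinovsky2013, eqs. (er8)–(er9) (arXiv text p. 1–2); Sahi2008, Prop. 12 (p. 219), Thm. 6 (p. 214)] -/
private theorem step_principal [DistribLattice α] [DecidableEq α] [DecidableLE α]
    (Cl : (α → ℝ) → Prop) (K : ℕ) {k : ℕ} (hFKG : ∀ μ, Cl μ → IsFKGMeasure μ)
    (hcond : ∀ μ, Cl μ → ∀ c : α, 0 < ∑ x ∈ principalUp c, μ x →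
      Cl (fun x => (if c ≤ x then μ x else 0) / ∑ x ∈ principalUp c, μ x))
    (ih : ∀ j, j ≤ k → ∀ (ν : α → ℝ), Cl ν → ∀ (h : Fin j → α → ℝ), (∀ i x, 0 ≤ h i x) →
      (∀ i, Monotone (h i)) → ∀ J : Finset (Fin j), J.card ≤ K →
      (∀ i, i ∉ J → IsLatticeCumulation (h i)) → 0 ≤ sahiE ν j h)
    {μ : α → ℝ} (hμCl : Cl μ) (c : α) (g : Fin k → α → ℝ) (hg0 : ∀ i x, 0 ≤ g i x)
    (hgm : ∀ i, Monotone (g i)) (J : Finset (Fin k)) (hJ : J.card ≤ K)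
    (hcum : ∀ i, i ∉ J → IsLatticeCumulation (g i)) :
    0 ≤ sahiE μ (k + 1) (Matrix.vecCons (setInd (principalUp c)) g) := by
  have hμ : IsFKGMeasure μ := hFKG μ hμCl
  set P := principalUp c with hP_def
  set m : ℝ := ∑ x ∈ P, μ x with hm_def
  have hm0 : 0 ≤ m := Finset.sum_nonneg fun x _ => hμ.nonneg x
  rcases hm0.eq_or_lt with hm | hm
  · -- `μ(↑c) = 0`: every term of the marked-slot formula vanishes
    have hz : ∀ x ∈ P, μ x = 0 := fun x hx =>
      (Finset.sum_eq_zero_iff_of_nonneg (fun y _ => hμ.nonneg y)).1 hm.symm x hx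
    rw [sahiE_cons_eq_sum μ hμ.sum_eq_one]
    refine le_of_eq (Finset.sum_eq_zero fun x _ => ?_).symm
    by_cases hx : x ∈ P
    · rw [hz x hx, zero_mul, zero_mul]
    · rw [setInd_apply, if_neg hx, mul_zero, zero_mul]
  · -- `μ(↑c) > 0`: condition on `↑c`
    set μ' : α → ℝ := fun x => (if c ≤ x then μ x else 0) / m with hμ'_def
    have hμ'P : ∀ x, m * μ' x = if x ∈ P then μ x else 0 := by
      intro x
      rw [hμ'_def]
      dsimp only
      rw [mul_div_cancel₀ _ hm.ne']
      simp only [hP_def, mem_principalUp]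
    have hμ' : IsFKGMeasure μ' := hμ.cond_principalUp c hm
    have hμ'Cl : Cl μ' := hcond μ hμCl c hm
    have H : ∀ ρ : Finset (Fin k), 0 ≤ ∑ x, (μ' x - μ x) * ∏ i ∈ ρ, g i x :=
      fun ρ => sum_cond_sub_mul_prod_nonneg hμ c hm hg0 hgm ρ
    -- positivity of `E_{j+1}(1, h)` under `μ'` for sub-families, from branching and `ih`
    have hcons : ∀ (j : ℕ) (h : Fin j → α → ℝ), j ≤ k → (∀ i x, 0 ≤ h i x) →
        (∀ i, Monotone (h i)) → ∀ J' : Finset (Fin j), J'.card ≤ K →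
        (∀ i, i ∉ J' → IsLatticeCumulation (h i)) → 0 ≤ sahiE μ' (j + 1) (Matrix.vecCons 1 h) := by
      intro j h hj hh0 hhm J' hJ' hcum'
      cases j with
      | zero =>
        show 0 ≤ sahiE μ' 1 _
        rw [sahiE_one_apply, Matrix.cons_val_zero, ex_one hμ'.sum_eq_one]
        exact zero_le_one
      | succ j =>
        rw [sahiE_one_cons hμ'.sum_eq_one]
        exact mul_nonneg (Nat.cast_nonneg _) (ih (j + 1) hj μ' hμ'Cl h hh0 hhm J' hJ' hcum')
    rw [sahiE_cons_setInd_decomp μ hμ.sum_eq_one μ' P m hμ'P g]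
    refine mul_nonneg hm.le (Finset.sum_nonneg fun S _ =>
      mul_nonneg ?_ (coeff_changeWeight_nonneg μ μ' g H _))
    -- the coefficient of `t^S` is `E_{|S|+1}(1, g|_S)` under `μ'`
    obtain ⟨j, hj⟩ : ∃ j, S.card = j := ⟨_, rfl⟩
    let e : Fin j ↪ Fin k := (S.orderEmbOfFin hj).toEmbedding
    have hmap : (univ : Finset (Fin j)).map e = S := map_univ_orderEmbOfFin S hj
    have hjk : j ≤ k := by
      rw [← hj]
      exact (Finset.card_le_univ S).trans (by rw [Fintype.card_fin])
    rw [← hmap, ← coeff_res e (qMark μ' univ g) univ, res_qMark, ← sahiE_cons_one_eq μ' hμ'.sum_eq_one]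
    refine hcons j (fun i => g (e i)) hjk (fun i x => hg0 _ x) (fun i => hgm _)
      (univ.filter fun i => e i ∈ J) ?_ ?_
    · refine le_trans ?_ hJ
      exact Finset.card_le_card_of_injOn (fun i => e i) (fun i hi => (Finset.mem_filter.1 hi).2)
        (fun a _ b _ hab => e.injective hab)
    · intro i hi
      refine hcum (e i) fun h => hi ?_
      exact Finset.mem_filter.2 ⟨Finset.mem_univ i, h⟩

/-- **Cumulation padding is free — the relative form of the argument.**  Let `Cl` be a class of FKG
probability weights on a finite distributive lattice which is closed under conditioning on principal up-sets
`{x | c ≤ x}` of positive mass (all FKG weights — Blinovsky's Lemma `IsFKGMeasure.cond_principalUp`; all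
product weights on a Boolean lattice — `bernoulliWeight_cond_principalUp` below), and suppose Sahi positivity
of order `K` holds for every weight of the class (`C_K` on `Cl`).  Then for every weight of the class, EVERY
`n`, and nonnegative monotone `f_0,…,f_{n-1}` all but at most `K` of which are cumulations (nonnegative
combinations of indicators of principal up-sets, Sahi's `𝒞`), `E_n(f_0,…,f_{n-1}) ≥ 0`: the peeling identity
`E_n^μ(1_{↑c}, g) = μ(↑c)·Σ_S (|S|-1)·E_{|S|}^{μ(·|↑c)}(g_S)·W_{Sᶜ}`, `W ≥ 0` (this file), removes the
cumulation slots one principal indicator at a time inside the class, until at most `K` functions remain.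
`K = 2` (`C_2` = FKG) is Blinovsky's theorem with two free slots (`sahiE_nonneg_of_isLatticeCumulation_offTwo`);
for general `K` this is the statement "`C_K` on the class implies `C_n` on the class for all `n`, restricted to
families with at most `K` non-cumulation slots" — the converse direction of the hierarchy `C_n ⇒ C_{n-1}`
(Lieb–Sahi) on the cumulation-padded families.  Not stated in the sources; it is what their arguments give.
[cite: Blinovsky2013, eq. (ee3) and Lemma (arXiv text pp. 1–2; PIT 50 (2014) 280–284); Sahi2008, Thm. 2
(p. 211), Thm. 6 (p. 214); LiebSahi2021, p. 3 (the hierarchy `C_n ⇒ C_{n-1}`)] -/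
theorem sahiE_nonneg_offK_of_condClosed [DistribLattice α] [DecidableEq α] [DecidableLE α]
    (Cl : (α → ℝ) → Prop) (K : ℕ) (hFKG : ∀ μ, Cl μ → IsFKGMeasure μ)
    (hcond : ∀ μ, Cl μ → ∀ c : α, 0 < ∑ x ∈ principalUp c, μ x →
      Cl (fun x => (if c ≤ x then μ x else 0) / ∑ x ∈ principalUp c, μ x))
    (hpos : ∀ μ, Cl μ → SahiPositive μ K)
    {μ : α → ℝ} (hμ : Cl μ) {n : ℕ} (f : Fin n → α → ℝ) (hf0 : ∀ i x, 0 ≤ f i x)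
    (hfm : ∀ i, Monotone (f i)) (I : Finset (Fin n)) (hI : I.card ≤ K)
    (hcum : ∀ i, i ∉ I → IsLatticeCumulation (f i)) : 0 ≤ sahiE μ n f := by
  induction n using Nat.strong_induction_on generalizing μ with
  | _ n ih =>
  by_cases hn : ∀ l : Fin n, l ∈ I
  · -- every slot is free: `n = |I| ≤ K`, and `C_K ⇒ C_n` on the class
    have hI' : I = univ := Finset.eq_univ_of_forall hn
    have hnK : n ≤ K := by
      rw [hI', Finset.card_univ, Fintype.card_fin] at hI
      exact hI
    exact (hpos μ hμ).anti (hFKG μ hμ).nonneg (hFKG μ hμ).sum_eq_one hnK f hf0 hfm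
  · -- a slot `l ∉ I` exists; it carries a cumulation
    push Not at hn
    obtain ⟨l, hl⟩ := hn
    obtain ⟨w, hw, hfl⟩ := hcum l hl
    -- linearise slot `l` into principal indicators
    have hf : f = Function.update f l (∑ c, w c • setInd (principalUp c)) := by
      rw [← eq_sum_smul_setInd_of_isLatticeCumulation hfl, Function.update_eq_self]
    rw [hf, sahiE_update_sum_smul]
    refine Finset.sum_nonneg fun c _ => mul_nonneg (hw c) ?_
    -- the family with the principal indicator `1_{↑c}` in slot `l`
    set f₁ : Fin n → α → ℝ := Function.update f l (setInd (principalUp c)) with hf₁_def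
    have hf₁0 : ∀ i x, 0 ≤ f₁ i x := by
      intro i x
      by_cases hi : i = l
      · subst hi; rw [hf₁_def, Function.update_self]; exact setInd_nonneg _ x
      · rw [hf₁_def, Function.update_of_ne hi]; exact hf0 i x
    have hf₁m : ∀ i, Monotone (f₁ i) := by
      intro i
      by_cases hi : i = l
      · subst hi; rw [hf₁_def, Function.update_self]; exact monotone_setInd (isUpperSet_principalUp c)
      · rw [hf₁_def, Function.update_of_ne hi]; exact hfm i
    have hf₁cum : ∀ i, i ∉ I → IsLatticeCumulation (f₁ i) := by
      intro i hi
      by_cases hil : i = l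
      · subst hil; rw [hf₁_def, Function.update_self]; exact isLatticeCumulation_setInd_principalUp _
      · rw [hf₁_def, Function.update_of_ne hil]; exact hcum i hi
    have hf₁l : f₁ l = setInd (principalUp c) := by rw [hf₁_def, Function.update_self]
    -- move slot `l` to slot `0`
    obtain ⟨k, rfl⟩ : ∃ k, n = k + 1 := ⟨n - 1, by have := l.pos; omega⟩
    let σ : Equiv.Perm (Fin (k + 1)) := Equiv.swap 0 l
    rw [← sahiE_comp_perm μ (k + 1) σ f₁]
    have hcons : (fun i => f₁ (σ i)) = Matrix.vecCons (setInd (principalUp c)) (fun j => f₁ (σ j.succ)) := by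
      have h := (Fin.cons_self_tail (fun i => f₁ (σ i))).symm
      have h0 : f₁ (σ 0) = setInd (principalUp c) := by
        simp only [σ, Equiv.swap_apply_left, hf₁l]
      rw [h0] at h
      exact h
    rw [hcons]
    refine step_principal Cl K hFKG hcond
      (fun j hj ν hν h hh0 hhm J hJ hJc => ih j (by omega) hν h hh0 hhm J hJ hJc)
      hμ c (fun j => f₁ (σ j.succ)) (fun j x => hf₁0 _ x) (fun j => hf₁m _)
      (univ.filter fun j => σ j.succ ∈ I) ?_ ?_
    · refine le_trans ?_ hI
      exact Finset.card_le_card_of_injOn (fun j => σ j.succ) (fun j hj => (Finset.mem_filter.1 hj).2)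
        (fun a _ b _ hab => Fin.succ_injective _ (σ.injective hab))
    · intro j hj
      refine hf₁cum (σ j.succ) fun h => hj ?_
      exact Finset.mem_filter.2 ⟨Finset.mem_univ j, h⟩

/-- **`C_K` for all FKG weights of a lattice gives `C_n` for all `n` on the families with at most `K`
non-cumulation slots.**  For a finite distributive lattice `α` on which every FKG probability weight is Sahi
positive of order `K`, every FKG probability weight `μ` on `α`, every `n`, and nonnegative monotone
`f_0,…,f_{n-1}` all but at most `K` of which are cumulations: `E_n(f) ≥ 0` (the class of all FKG weights is
closed under principal conditioning by Blinovsky's Lemma).  `K = 2`: `sahiE_nonneg_of_isLatticeCumulation_offTwo`.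
[cite: Blinovsky2013, eq. (ee3) and Lemma (arXiv text pp. 1–2); Sahi2008, Thm. 2 (p. 211); LiebSahi2021,
p. 3 (hierarchy)] -/
theorem sahiE_nonneg_of_isLatticeCumulation_offK [DistribLattice α] [DecidableEq α] [DecidableLE α]
    (K : ℕ) (hC : ∀ ν : α → ℝ, IsFKGMeasure ν → SahiPositive ν K)
    {μ : α → ℝ} (hμ : IsFKGMeasure μ) {n : ℕ} (f : Fin n → α → ℝ) (hf0 : ∀ i x, 0 ≤ f i x)
    (hfm : ∀ i, Monotone (f i)) (I : Finset (Fin n)) (hI : I.card ≤ K)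
    (hcum : ∀ i, i ∉ I → IsLatticeCumulation (f i)) : 0 ≤ sahiE μ n f :=
  sahiE_nonneg_offK_of_condClosed IsFKGMeasure K (fun _ h => h)
    (fun _ hν c hm => hν.cond_principalUp c hm) hC hμ f hf0 hfm I hI hcum

/-- **The padded hierarchy collapses to its first `K` levels (FKG weights of a fixed lattice):** order-`K`
Sahi positivity of every FKG probability weight on `α` is EQUIVALENT to `E_n ≥ 0` for every FKG probability
weight on `α`, every `n`, and every nonnegative monotone family with at most `K` non-cumulation slots.
(`→`: `sahiE_nonneg_of_isLatticeCumulation_offK`; `←`: take `n = K` and all slots free.)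
[cite: LiebSahi2021, p. 3 (the hierarchy `C_n ⇒ C_{n-1}`); Blinovsky2013, eq. (ee3); Sahi2008, Thm. 2
(p. 211)] -/
theorem forall_sahiPositive_iff_forall_offK [DistribLattice α] [DecidableEq α] [DecidableLE α] (K : ℕ) :
    (∀ ν : α → ℝ, IsFKGMeasure ν → SahiPositive ν K) ↔
      ∀ ν : α → ℝ, IsFKGMeasure ν → ∀ (n : ℕ) (f : Fin n → α → ℝ), (∀ i x, 0 ≤ f i x) →
        (∀ i, Monotone (f i)) → ∀ I : Finset (Fin n), I.card ≤ K →
        (∀ i, i ∉ I → IsLatticeCumulation (f i)) → 0 ≤ sahiE ν n f := by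
  constructor
  · intro hC ν hν n f hf0 hfm I hI hcum
    exact sahiE_nonneg_of_isLatticeCumulation_offK K hC hν f hf0 hfm I hI hcum
  · intro h ν hν f hf0 hfm
    exact h ν hν K f hf0 hfm univ (by simp) (fun i hi => absurd (mem_univ i) hi)

/-- **Sahi's `n`-function inequality for cumulations under FKG measures (Blinovsky), with two free slots.**
For an FKG probability weight `μ` on a finite distributive lattice, every `n`, and nonnegative monotone
`f_0,…,f_{n-1}` all but at most two of which are cumulations (nonnegative combinations of indicators of
principal up-sets `{x | c ≤ x}` — Sahi's class `𝒞`), `E_n(f_0,…,f_{n-1}) ≥ 0`.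

Printed statements covered: Sahi's Theorem 2 (all slots in `𝒞`, product measures) and Blinovsky's extension
of it to arbitrary FKG measures (all slots in `𝒞`; printed proof = the case `n = 3` plus "the case of an
arbitrary `n` is similar").  The proof here is not Blinovsky's interpolation `E^k_{n,μ}`: it peels one principal
slot `1_{↑c}` by the exact identity
`E_n^μ(1_{↑c}, g) = μ(↑c)·Σ_{S} (|S|-1)·E_{|S|}^{μ(·|↑c)}(g_S)·W_{Sᶜ}`, where the change-of-weight factor
`W = ∏_x (1 - Σ t_i g_i(x))^{μ(x)-μ(x|↑c)}` has nonnegative coefficients by the FKG inequality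
(`coeff_changeWeight_nonneg`, Euler-derivation argument) — which is why only the peeled slots need to be
cumulations and two slots may be arbitrary monotone functions (the base of the induction is `C_2` = FKG;
`sahiE_nonneg_of_isLatticeCumulation_offK` with `K = 2`).
[cite: Blinovsky2013, eq. (ee3) and its proof (arXiv text pp. 1–2, PIT 50 (2014) 280–284); Sahi2008,
Thm. 2 (p. 211)] -/
theorem sahiE_nonneg_of_isLatticeCumulation_offTwo [DistribLattice α] [DecidableEq α] [DecidableLE α]
    {μ : α → ℝ} (hμ : IsFKGMeasure μ) {n : ℕ} (f : Fin n → α → ℝ) (hf0 : ∀ i x, 0 ≤ f i x)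
    (hfm : ∀ i, Monotone (f i)) (I : Finset (Fin n)) (hI : I.card ≤ 2)
    (hcum : ∀ i, i ∉ I → IsLatticeCumulation (f i)) : 0 ≤ sahiE μ n f :=
  sahiE_nonneg_of_isLatticeCumulation_offK 2 (fun _ hν => sahiPositive_two hν) hμ f hf0 hfm I hI hcum

/-- **Blinovsky 2014 (PIT 50), verbatim class: all slots cumulations.**  For an FKG probability weight on a
finite distributive lattice and `f_0,…,f_{n-1} ∈ 𝒞` (nonnegative combinations of indicators of principal
up-sets — "linear combinations of unimodal Boolean monotone nondecreasing functions with nonnegative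
coefficients"), `E_n(f_0,…,f_{n-1}) ≥ 0` — Sahi's Theorem 2 with the product measure replaced by an arbitrary
FKG measure. [cite: Blinovsky2013, eq. (ee3) (arXiv text p. 1; PIT 50 (2014) 280–284); Sahi2008, Thm. 2
(p. 211)] -/
theorem sahiE_nonneg_of_isLatticeCumulation [DistribLattice α] [DecidableEq α] [DecidableLE α]
    {μ : α → ℝ} (hμ : IsFKGMeasure μ) {n : ℕ} (f : Fin n → α → ℝ)
    (hcum : ∀ i, IsLatticeCumulation (f i)) : 0 ≤ sahiE μ n f := by
  have hnn : ∀ {g : α → ℝ}, IsLatticeCumulation g → ∀ x, 0 ≤ g x := by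
    intro g hg x
    obtain ⟨c, hc, rfl⟩ := hg
    exact Finset.sum_nonneg fun y _ => by split_ifs <;> [exact hc y; exact le_rfl]
  have hmono : ∀ {g : α → ℝ}, IsLatticeCumulation g → Monotone g := by
    intro g hg x y hxy
    obtain ⟨c, hc, rfl⟩ := hg
    refine Finset.sum_le_sum fun z _ => ?_
    by_cases hz : z ≤ x
    · rw [if_pos hz, if_pos (le_trans hz hxy)]
    · rw [if_neg hz]
      split_ifs <;> [exact hc z; exact le_rfl]
  exact sahiE_nonneg_of_isLatticeCumulation_offTwo hμ f (fun i => hnn (hcum i)) (fun i => hmono (hcum i))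
    ∅ (by simp) (fun i _ => hcum i)

/-- **Blinovsky's theorem as order-`n` Sahi positivity restricted to `𝒞` with two free slots, `cons` form:**
for nonnegative monotone `f, g` and cumulations `h_0,…,h_{n-1}`, `E_{n+2}(f, g, h_0,…,h_{n-1}) ≥ 0` under
every FKG probability weight — the `n`-function extension of the tree's `n = 3` theorem
`sahiE_three_nonneg_of_monotone_of_isLatticeCumulation`. [cite: Blinovsky2013, eq. (ee3) and Lemma
(arXiv text p. 1); Sahi2008, Thm. 2 (p. 211)] -/
theorem sahiE_cons_cons_nonneg_of_isLatticeCumulation [DistribLattice α] [DecidableEq α] [DecidableLE α]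
    {μ : α → ℝ} (hμ : IsFKGMeasure μ) {n : ℕ} {f g : α → ℝ} (hf : ∀ x, 0 ≤ f x) (hfm : Monotone f)
    (hg : ∀ x, 0 ≤ g x) (hgm : Monotone g) (h : Fin n → α → ℝ) (hh : ∀ i, IsLatticeCumulation (h i)) :
    0 ≤ sahiE μ (n + 2) (Matrix.vecCons f (Matrix.vecCons g h)) := by
  have hnn : ∀ {q : α → ℝ}, IsLatticeCumulation q → ∀ x, 0 ≤ q x := by
    intro q hq x
    obtain ⟨c, hc, rfl⟩ := hq
    exact Finset.sum_nonneg fun y _ => by split_ifs <;> [exact hc y; exact le_rfl]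
  have hmono : ∀ {q : α → ℝ}, IsLatticeCumulation q → Monotone q := by
    intro q hq x y hxy
    obtain ⟨c, hc, rfl⟩ := hq
    refine Finset.sum_le_sum fun z _ => ?_
    by_cases hz : z ≤ x
    · rw [if_pos hz, if_pos (le_trans hz hxy)]
    · rw [if_neg hz]
      split_ifs <;> [exact hc z; exact le_rfl]
  refine sahiE_nonneg_of_isLatticeCumulation_offTwo hμ _ ?_ ?_ {0, 1} (Finset.card_le_two) ?_
  · intro i x
    refine Fin.cases (hf x) (fun j => ?_) i
    refine Fin.cases (hg x) (fun j' => ?_) j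
    simpa using hnn (hh j') x
  · intro i
    refine Fin.cases hfm (fun j => ?_) i
    refine Fin.cases hgm (fun j' => ?_) j
    simpa using hmono (hh j')
  · intro i hi
    have h0 : i ≠ 0 := fun h => hi (by simp [h])
    have h1 : i ≠ 1 := fun h => hi (by simp [h])
    obtain ⟨j, rfl⟩ := Fin.exists_succ_eq.2 h0
    have hj : j ≠ 0 := fun h => h1 (by simp [h])
    obtain ⟨j', rfl⟩ := Fin.exists_succ_eq.2 hj
    simpa using hh j'

/-- **Sahi's Theorem 2 for FKG measures on the Boolean lattice** (Blinovsky's setting `2^[m]` verbatim, in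
the vocabulary of `Sahi2008/CumulationCone.lean`): for an FKG probability weight `μ` on `Finset ι` and
`f_0,…,f_{n-1}` in the cell's cumulation cone `IsCumulation` (`c⁺(T) = Σ_{S⊆T} c(S)`, `c ≥ 0`),
`E_n(f) ≥ 0`.  (`sahi2008_thm2` is the product-measure case.) [cite: Blinovsky2013, eq. (ee3) (arXiv text
p. 1); Sahi2008, Thm. 2 (p. 211)] -/
theorem sahi2008_thm2_fkg {ι : Type*} [DecidableEq ι] [Fintype ι] (μ : Finset ι → ℝ)
    (hμ : IsFKGMeasure μ) {n : ℕ} (f : Fin n → Finset ι → ℝ) (hf : ∀ i, IsCumulation (f i)) :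
    0 ≤ sahiE μ n f :=
  sahiE_nonneg_of_isLatticeCumulation hμ f fun i => isLatticeCumulation_of_isCumulation (hf i)

/-- **The conditioning inequality** (sharp form of Blinovsky's comparison (er9)
`E_{n,μ} ≥ μ(A_n)^n E_{n,μ_{A_n}}`): for an FKG probability weight `μ`, `c` with `μ(↑c) > 0`,
`μ' = μ(·| ↑c)`, and nonnegative monotone `g_0,…,g_k` all but at most two of which are cumulations,
`μ(↑c) · k · E_{k+1}^{μ'}(g_0,…,g_k) ≤ E_{k+2}^{μ}(1_{↑c}, g_0,…,g_k)` — the `S = univ` term of the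
conditioning identity (all other terms being nonnegative). [cite: Blinovsky2013, eq. (er9) (arXiv text
p. 2); Sahi2008, Thm. 6 (p. 214)] -/
theorem sahiE_cons_principalUp_ge [DistribLattice α] [DecidableEq α] [DecidableLE α] {μ : α → ℝ}
    (hμ : IsFKGMeasure μ) (c : α) (hm : 0 < ∑ x ∈ principalUp c, μ x) {k : ℕ}
    (g : Fin (k + 1) → α → ℝ) (hg0 : ∀ i x, 0 ≤ g i x) (hgm : ∀ i, Monotone (g i))
    (J : Finset (Fin (k + 1))) (hJ : J.card ≤ 2) (hcum : ∀ i, i ∉ J → IsLatticeCumulation (g i)) :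
    (∑ x ∈ principalUp c, μ x) *
        (k * sahiE (fun x => (if c ≤ x then μ x else 0) / ∑ x ∈ principalUp c, μ x) (k + 1) g) ≤
      sahiE μ (k + 2) (Matrix.vecCons (setInd (principalUp c)) g) := by
  set P := principalUp c with hP_def
  set m : ℝ := ∑ x ∈ P, μ x with hm_def
  set μ' : α → ℝ := fun x => (if c ≤ x then μ x else 0) / m with hμ'_def
  have hμ'P : ∀ x, m * μ' x = if x ∈ P then μ x else 0 := by
    intro x
    rw [hμ'_def]
    dsimp only
    rw [mul_div_cancel₀ _ hm.ne']
    simp only [hP_def, mem_principalUp]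
  have hμ' : IsFKGMeasure μ' := hμ.cond_principalUp c hm
  have H : ∀ ρ : Finset (Fin (k + 1)), 0 ≤ ∑ x, (μ' x - μ x) * ∏ i ∈ ρ, g i x :=
    fun ρ => sum_cond_sub_mul_prod_nonneg hμ c hm hg0 hgm ρ
  have hW := coeff_changeWeight_nonneg μ μ' g H
  -- every term of the conditioning identity is nonnegative
  have hterm : ∀ S ∈ (univ : Finset (Fin (k + 1))).powerset,
      0 ≤ (qMark μ' univ g).coeff S * (∏ x, binomB (μ x - μ' x) (lin g x)).coeff (univ \ S) := by
    intro S _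
    refine mul_nonneg ?_ (hW _)
    obtain ⟨j, hj⟩ : ∃ j, S.card = j := ⟨_, rfl⟩
    let e : Fin j ↪ Fin (k + 1) := (S.orderEmbOfFin hj).toEmbedding
    have hmap : (univ : Finset (Fin j)).map e = S := map_univ_orderEmbOfFin S hj
    rw [← hmap, ← coeff_res e (qMark μ' univ g) univ, res_qMark, ← sahiE_cons_one_eq μ' hμ'.sum_eq_one]
    cases j with
    | zero =>
      show 0 ≤ sahiE μ' 1 _
      rw [sahiE_one_apply, Matrix.cons_val_zero, ex_one hμ'.sum_eq_one]
      exact zero_le_one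
    | succ j =>
      rw [sahiE_one_cons hμ'.sum_eq_one]
      refine mul_nonneg (Nat.cast_nonneg _) ?_
      refine sahiE_nonneg_of_isLatticeCumulation_offTwo hμ' (fun i => g (e i)) (fun i x => hg0 _ x)
        (fun i => hgm _) (univ.filter fun i => e i ∈ J) ?_ ?_
      · refine le_trans ?_ hJ
        exact Finset.card_le_card_of_injOn (fun i => e i) (fun i hi => (Finset.mem_filter.1 hi).2)
          (fun a _ b _ hab => e.injective hab)
      · intro i hi
        refine hcum (e i) fun h => hi ?_
        exact Finset.mem_filter.2 ⟨Finset.mem_univ i, h⟩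
  -- the `S = univ` term is `E_{k+2}^{μ'}(1, g) · W_∅ = k · E_{k+1}^{μ'}(g)`
  have huniv : (qMark μ' univ g).coeff univ *
      (∏ x, binomB (μ x - μ' x) (lin g x)).coeff (univ \ univ) = k * sahiE μ' (k + 1) g := by
    rw [sdiff_self, Finset.bot_eq_empty, coeff_empty_prod,
      Finset.prod_eq_one (fun x _ => coeff_empty_binomB (isNil_lin g x) _), mul_one,
      ← sahiE_cons_one_eq μ' hμ'.sum_eq_one, sahiE_one_cons hμ'.sum_eq_one]
  rw [sahiE_cons_setInd_decomp μ hμ.sum_eq_one μ' P m hμ'P g, ← huniv]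
  exact mul_le_mul_of_nonneg_left (Finset.single_le_sum hterm (Finset.mem_powerset.2 (subset_univ _)))
    hm.le

end Main

/-! ## Product weights on a Boolean lattice

The class of product weights `bernoulliWeight p` (`p ∈ [0,1]^ι`) on the Boolean lattice `Set ι` is closed under
conditioning on principal up-sets `{ω | c ⊆ ω}` ("the coordinates of `c` are all `1`") of positive mass: the
conditional weight is the product weight with the coordinates of `c` frozen to `1`.  Hence Sahi positivity of
order `K` for all product weights on `Set ι` gives `E_n ≥ 0`, every `n`, for all product weights on `Set ι` and
all nonnegative monotone families with at most `K` non-cumulation slots — for events: `K` arbitrary increasing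
events padded by cylinder events `{ω | S ⊆ ω}` ("all coordinates of `S` are `1`").  At `K = 2` (Harris) this is
unconditional. -/

section Product

open Literature.Probability.LatticeModels (principalUp mem_principalUp isUpperSet_principalUp prodBernoulli
  sahiE3 sahiE4)
open Literature.Probability.Percolation.BHK2006 (weight)
open Literature.Probability.Percolation.DecisionTree (ind ind_of_mem ind_of_not_mem ind_nonneg)

variable {ι : Type*} [Fintype ι]

/-- Freezing the coordinates of `c` to `1`: pointwise in `ω`,
`1_{c ⊆ ω}·w_p(ω) = (∏_{e∈c} p_e)·w_{p'}(ω)` with `p'_e = 1` for `e ∈ c` and `p'_e = p_e` otherwise (the factors of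
the product weight at the coordinates of `c`). [cite: Sahi2008, eq. (2) (p. 210) (the product measure
`μ(S) = Π_{x∈S} m_x Π_{y∉S}(1 − m_y)`)] -/
theorem ite_le_bernoulliWeight_eq (p : ι → unitInterval) (c ω : Set ι) [Decidable (c ≤ ω)]
    [DecidablePred (· ∈ c)] :
    (if c ≤ ω then bernoulliWeight p ω else 0) =
      (∏ e, if e ∈ c then (p e : ℝ) else 1) * bernoulliWeight (fun e => if e ∈ c then 1 else p e) ω := by
  by_cases hcω : c ≤ ω
  · rw [if_pos hcω]
    show weight _ ω = _ * weight _ ω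
    unfold weight
    rw [← Finset.prod_mul_distrib]
    refine Finset.prod_congr rfl fun e _ => ?_
    by_cases hec : e ∈ c
    · have heω : e ∈ ω := hcω hec
      simp [hec, heω]
    · simp [hec]
  · rw [if_neg hcω]
    obtain ⟨e, hec, heω⟩ := Set.not_subset.1 hcω
    have h0 : bernoulliWeight (fun e => if e ∈ c then 1 else p e) ω = 0 := by
      show weight _ ω = 0
      unfold weight
      exact Finset.prod_eq_zero (Finset.mem_univ e) (by simp [hec, heω])
    rw [h0, mul_zero]

/-- The mass of the principal up-set `{ω | c ⊆ ω}` under the product weight is `∏_{e∈c} p_e`.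
[cite: Sahi2008, eq. (2) (p. 210)] -/
theorem sum_principalUp_bernoulliWeight [DecidableLE (Set ι)] (p : ι → unitInterval) (c : Set ι)
    [DecidablePred (· ∈ c)] :
    ∑ ω ∈ principalUp c, bernoulliWeight p ω = ∏ e, if e ∈ c then (p e : ℝ) else 1 := by
  have h : ∑ ω ∈ principalUp c, bernoulliWeight p ω =
      ∑ ω, if c ≤ ω then bernoulliWeight p ω else 0 := by
    rw [show principalUp c = univ.filter (fun ω => c ≤ ω) from rfl, Finset.sum_filter]
  rw [h, Finset.sum_congr rfl fun ω _ => ite_le_bernoulliWeight_eq p c ω, ← Finset.mul_sum,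
    sum_bernoulliWeight, mul_one]

/-- **Product weights are closed under principal conditioning:** conditioning the product weight `w_p` on the
principal up-set `{ω | c ⊆ ω}` (of positive mass) gives the product weight with the coordinates of `c` frozen to
`1`. [cite: Sahi2008, eq. (2) (p. 210); Blinovsky2013, Lemma (arXiv text p. 1) (the FKG-measure analogue)] -/
theorem bernoulliWeight_cond_principalUp [DecidableLE (Set ι)] (p : ι → unitInterval) (c : Set ι)
    [DecidablePred (· ∈ c)] (hm : 0 < ∑ ω ∈ principalUp c, bernoulliWeight p ω) :
    (fun ω => (if c ≤ ω then bernoulliWeight p ω else 0) / ∑ ω ∈ principalUp c, bernoulliWeight p ω) =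
      bernoulliWeight (fun e => if e ∈ c then 1 else p e) := by
  funext ω
  rw [sum_principalUp_bernoulliWeight] at hm ⊢
  rw [ite_le_bernoulliWeight_eq p c ω, mul_div_cancel_left₀ _ hm.ne']

/-- **`C_K` for product weights gives the padded `C_n` for product weights, every `n`.**  If every product
weight on the Boolean lattice `Set ι` is Sahi positive of order `K`, then for every product weight on `Set ι`,
every `n`, and nonnegative monotone `f_0,…,f_{n-1}` all but at most `K` of which are cumulations (nonnegative
combinations of cylinder indicators `1_{c ⊆ ω}`), `E_n(f) ≥ 0`.  (`K = 3`: Kahn's form of Sahi's question for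
three increasing events under a product measure would give all the padded orders.) [cite: Sahi2008, Thm. 2
(p. 211) and eq. (2) (p. 210); Blinovsky2013, eq. (ee3); LiebSahi2021, p. 3 (hierarchy); Kahn2022, Conj. 5
(arXiv p. 3)] -/
theorem sahiE_bernoulliWeight_nonneg_offK [DecidableEq (Set ι)] [DecidableLE (Set ι)] (K : ℕ)
    (hC : ∀ p : ι → unitInterval, SahiPositive (bernoulliWeight p) K) (p : ι → unitInterval) {n : ℕ}
    (f : Fin n → Set ι → ℝ) (hf0 : ∀ i x, 0 ≤ f i x) (hfm : ∀ i, Monotone (f i)) (I : Finset (Fin n))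
    (hI : I.card ≤ K) (hcum : ∀ i, i ∉ I → IsLatticeCumulation (f i)) :
    0 ≤ sahiE (bernoulliWeight p) n f := by
  classical
  refine sahiE_nonneg_offK_of_condClosed (fun μ => ∃ q : ι → unitInterval, μ = bernoulliWeight q) K
    ?_ ?_ ?_ ⟨p, rfl⟩ f hf0 hfm I hI hcum
  · rintro μ ⟨q, rfl⟩
    exact isFKGMeasure_bernoulliWeight q
  · rintro μ ⟨q, rfl⟩ c hm
    exact ⟨_, bernoulliWeight_cond_principalUp q c hm⟩
  · rintro μ ⟨q, rfl⟩
    exact hC q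

/-- **The padded hierarchy collapses to its first `K` levels (product weights on a fixed coordinate set):**
order-`K` Sahi positivity of every product weight on `Set ι` is EQUIVALENT to `E_n ≥ 0` for every product weight
on `Set ι`, every `n`, and every nonnegative monotone family with at most `K` non-cumulation slots.
[cite: LiebSahi2021, p. 3 (hierarchy); Sahi2008, Thm. 2 (p. 211); Kahn2022, Conj. 5 (arXiv p. 3)] -/
theorem forall_sahiPositive_bernoulliWeight_iff_forall_offK [DecidableEq (Set ι)] [DecidableLE (Set ι)]
    (K : ℕ) :
    (∀ p : ι → unitInterval, SahiPositive (bernoulliWeight p) K) ↔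
      ∀ (p : ι → unitInterval) (n : ℕ) (f : Fin n → Set ι → ℝ), (∀ i x, 0 ≤ f i x) →
        (∀ i, Monotone (f i)) → ∀ I : Finset (Fin n), I.card ≤ K →
        (∀ i, i ∉ I → IsLatticeCumulation (f i)) → 0 ≤ sahiE (bernoulliWeight p) n f := by
  constructor
  · intro hC p n f hf0 hfm I hI hcum
    exact sahiE_bernoulliWeight_nonneg_offK K hC p f hf0 hfm I hI hcum
  · intro h p f hf0 hfm
    exact h p K f hf0 hfm univ (by simp)
      (fun i hi => absurd (mem_univ i) hi)

/-! ### Event form: increasing events padded by cylinder events -/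

/-- The indicator of the cylinder event `{ω | S ⊆ ω}` ("all coordinates of `S` are `1`") is the indicator of a
principal up-set of the lattice `Set ι`, hence a cumulation. [cite: Sahi2008, p. 210 (the class 𝒞[X]:
indicators of `{T | T ⊇ S}`)] -/
theorem isLatticeCumulation_ind_cylinder [DecidableEq (Set ι)] [DecidableLE (Set ι)] (S : Set ι) :
    IsLatticeCumulation (ind {ω : Set ι | S ⊆ ω}) := by
  have h : ind {ω : Set ι | S ⊆ ω} = setInd (principalUp S) := by
    funext ω
    rw [setInd_apply]
    by_cases hω : S ⊆ ω
    · rw [ind_of_mem (show ω ∈ {ω : Set ι | S ⊆ ω} from hω), if_pos (mem_principalUp.2 hω)]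
    · rw [ind_of_not_mem (show ω ∉ {ω : Set ι | S ⊆ ω} from hω),
        if_neg (fun h => hω (mem_principalUp.1 h))]
  rw [h]
  exact isLatticeCumulation_setInd_principalUp S

/-- **Event form of the padding theorem for product measures.**  Assuming order-`K` Sahi positivity of all
product weights on `Set ι`: for events `A_0,…,A_{n-1} ⊆ 2^ι` such that the `A_i`, `i ∈ I` (`|I| ≤ K`) are
increasing and the others are cylinder events `{ω | S_i ⊆ ω}`, `E_n(1_{A_0},…,1_{A_{n-1}}) ≥ 0` under every
product weight. [cite: Sahi2008, Thm. 2 (p. 211), eq. (2) (p. 210); Kahn2022, Conj. 5 (arXiv p. 3);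
LiebSahi2021, p. 3] -/
theorem sahiE_bernoulliWeight_ind_nonneg_offK (K : ℕ)
    (hC : ∀ p : ι → unitInterval, SahiPositive (bernoulliWeight p) K) (p : ι → unitInterval) {n : ℕ}
    (A : Fin n → Set (Set ι)) (I : Finset (Fin n)) (hI : I.card ≤ K) (hA : ∀ i, i ∈ I → IsUpperSet (A i))
    (S : Fin n → Set ι) (hS : ∀ i, i ∉ I → A i = {ω | S i ⊆ ω}) :
    0 ≤ sahiE (bernoulliWeight p) n (fun i => ind (A i)) := by
  classical
  refine sahiE_bernoulliWeight_nonneg_offK K hC p _ (fun i ω => ind_nonneg _ _) (fun i => ?_) I hI ?_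
  · by_cases hi : i ∈ I
    · exact monotone_ind_of_isUpperSet (hA i hi)
    · rw [hS i hi]
      exact monotone_ind_of_isUpperSet fun ω ω' hle (hω : S i ⊆ ω) => hω.trans hle
  · intro i hi
    rw [hS i hi]
    exact isLatticeCumulation_ind_cylinder (S i)

/-- **Unconditional case `K = 2` (Harris), event form:** for a product measure on `2^ι`, two arbitrary increasing
events `A, B` and any cylinder events `{ω | S_j ⊆ ω}`, `E_n(1_A, 1_B, 1_{S_2 ⊆ ω}, …, 1_{S_{n-1} ⊆ ω}) ≥ 0` —
written for a general placement `I`, `|I| ≤ 2`, of the two free slots. [cite: Blinovsky2013, eq. (ee3);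
Sahi2008, Thm. 2 (p. 211); Harris1960 (the base `C_2`)] -/
theorem sahiE_bernoulliWeight_ind_nonneg_offTwo (p : ι → unitInterval) {n : ℕ}
    (A : Fin n → Set (Set ι)) (I : Finset (Fin n)) (hI : I.card ≤ 2) (hA : ∀ i, i ∈ I → IsUpperSet (A i))
    (S : Fin n → Set ι) (hS : ∀ i, i ∉ I → A i = {ω | S i ⊆ ω}) :
    0 ≤ sahiE (bernoulliWeight p) n (fun i => ind (A i)) :=
  sahiE_bernoulliWeight_ind_nonneg_offK 2 (fun q => sahiPositive_two (isFKGMeasure_bernoulliWeight q)) p A I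
    hI hA S hS

/-- **`E_4 ≥ 0` for two increasing events and two cylinder events under a product measure** (measure form, via
the tree's `sahiE4`): `E_4(A, B, {S ⊆ ω}, {T ⊆ ω}) ≥ 0` for increasing `A, B ⊆ 2^ι`, any `S, T ⊆ ι`, and
`μ = prodBernoulli p`. [cite: Blinovsky2013, eq. (ee3); Sahi2008, Thm. 2 (p. 211); LiebSahi2021, Def. 3.1
(`E_4`)] -/
theorem sahiE4_prodBernoulli_nonneg_of_cylinders (p : ι → unitInterval) {A B : Set (Set ι)}
    (hA : IsUpperSet A) (hB : IsUpperSet B) (S T : Set ι) :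
    0 ≤ sahiE4 (prodBernoulli p) A B {ω | S ⊆ ω} {ω | T ⊆ ω} := by
  rw [← sahiE_four_ind]
  have h := sahiE_bernoulliWeight_ind_nonneg_offTwo p ![A, B, {ω | S ⊆ ω}, {ω | T ⊆ ω}] {0, 1}
    Finset.card_le_two ?_ ![∅, ∅, S, T] ?_
  · convert h using 2
    funext i
    fin_cases i <;> rfl
  · intro i hi
    simp only [Finset.mem_insert, Finset.mem_singleton] at hi
    rcases hi with rfl | rfl
    · exact hA
    · exact hB
  · intro i hi
    fin_cases i
    · exact absurd (by simp) hi
    · exact absurd (by simp) hi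
    · rfl
    · rfl

end Product

/-! ## The order dual: decreasing events padded by "closed" cylinders

Percolation separation events are DEcreasing.  On the order dual `(Set ι)ᵒᵈ` the product weight
(`bernoulliWeightDual p`, the tree's carrier of decreasing events) is again a principal-conditioning-closed class:
the principal up-sets of `(Set ι)ᵒᵈ` are `{ω | ω ⊆ C}` ("all coordinates outside `C` are `0`"), and conditioning
on one freezes the coordinates outside `C` to `0`.  Since `(Set ι)ᵒᵈ`, its `Fintype` structure and `OrderDual.ofDual`
are definitionally `Set ι`, its structure and the identity, the conclusions are stated directly for
`sahiE (bernoulliWeight p)` / `sahiE4 (prodBernoulli p)` with decreasing events. -/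

section ProductDual

open Literature.Probability.LatticeModels (principalUp mem_principalUp isUpperSet_principalUp prodBernoulli
  sahiE3 sahiE4)
open Literature.Probability.Percolation.BHK2006 (weight)
open Literature.Probability.Percolation.DecisionTree (ind ind_of_mem ind_of_not_mem ind_nonneg)

variable {ι : Type*} [Fintype ι]

/-- Freezing the coordinates outside `C` to `0`: pointwise in `ω`,
`1_{ω ⊆ C}·w_p(ω) = (∏_{e∉C} (1 - p_e))·w_{p'}(ω)` with `p'_e = p_e` for `e ∈ C` and `p'_e = 0` otherwise, written on
the order dual (`c ≤ a` in `(Set ι)ᵒᵈ` is `ofDual a ⊆ ofDual c`). [cite: Sahi2008, eq. (2) (p. 210); LiebSahi2021,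
footnote 2 (order reversal)] -/
theorem ite_le_bernoulliWeightDual_eq (p : ι → unitInterval) (c a : (Set ι)ᵒᵈ) [Decidable (c ≤ a)]
    [DecidablePred (· ∈ OrderDual.ofDual c)] :
    (if c ≤ a then bernoulliWeightDual p a else 0) =
      (∏ e, if e ∈ OrderDual.ofDual c then (1 : ℝ) else 1 - p e) *
        bernoulliWeightDual (fun e => if e ∈ OrderDual.ofDual c then p e else 0) a := by
  -- `c ≤ a` in `(Set ι)ᵒᵈ` is `ofDual a ⊆ ofDual c`
  have hle : (c ≤ a) ↔ OrderDual.ofDual a ⊆ OrderDual.ofDual c := Iff.rfl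
  by_cases hca : c ≤ a
  · have hωC : OrderDual.ofDual a ⊆ OrderDual.ofDual c := hle.1 hca
    rw [if_pos hca]
    show weight _ (OrderDual.ofDual a) = _ * weight _ (OrderDual.ofDual a)
    unfold weight
    rw [← Finset.prod_mul_distrib]
    refine Finset.prod_congr rfl fun e _ => ?_
    by_cases heC : e ∈ OrderDual.ofDual c
    · simp [heC]
    · have heω : e ∉ OrderDual.ofDual a := fun h => heC (hωC h)
      simp [heC, heω]
  · rw [if_neg hca]
    have hωC : ¬ OrderDual.ofDual a ⊆ OrderDual.ofDual c := fun h => hca (hle.2 h)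
    obtain ⟨e, heω, heC⟩ := Set.not_subset.1 hωC
    have h0 : bernoulliWeightDual (fun e => if e ∈ OrderDual.ofDual c then p e else 0) a = 0 := by
      show weight _ (OrderDual.ofDual a) = 0
      unfold weight
      exact Finset.prod_eq_zero (Finset.mem_univ e) (by simp [heC, heω])
    rw [h0, mul_zero]

/-- The mass of the principal up-set `{ω | ω ⊆ C}` of the order dual under the product weight is
`∏_{e∉C} (1 - p_e)`. [cite: Sahi2008, eq. (2) (p. 210); LiebSahi2021, footnote 2] -/
theorem sum_principalUp_bernoulliWeightDual [DecidableLE (Set ι)ᵒᵈ] (p : ι → unitInterval) (c : (Set ι)ᵒᵈ)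
    [DecidablePred (· ∈ OrderDual.ofDual c)] :
    ∑ a ∈ principalUp c, bernoulliWeightDual p a = ∏ e, if e ∈ OrderDual.ofDual c then (1 : ℝ) else 1 - p e := by
  have h : ∑ a ∈ principalUp c, bernoulliWeightDual p a =
      ∑ a, if c ≤ a then bernoulliWeightDual p a else 0 := by
    rw [show principalUp c = univ.filter (fun a => c ≤ a) from rfl, Finset.sum_filter]
  have hsum : ∑ a : (Set ι)ᵒᵈ, bernoulliWeightDual (fun e => if e ∈ OrderDual.ofDual c then p e else 0) a = 1 :=
    (isFKGMeasure_bernoulliWeightDual _).sum_eq_one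
  rw [h, Finset.sum_congr rfl fun a _ => ite_le_bernoulliWeightDual_eq p c a, ← Finset.mul_sum, hsum, mul_one]

/-- **Dual product weights are closed under principal conditioning:** conditioning `bernoulliWeightDual p` on the
principal up-set `{ω | ω ⊆ C}` of `(Set ι)ᵒᵈ` (of positive mass) gives the dual product weight with the coordinates
outside `C` frozen to `0`. [cite: Sahi2008, eq. (2) (p. 210); Blinovsky2013, Lemma (arXiv text p. 1);
LiebSahi2021, footnote 2] -/
theorem bernoulliWeightDual_cond_principalUp [DecidableLE (Set ι)ᵒᵈ] (p : ι → unitInterval) (c : (Set ι)ᵒᵈ)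
    [DecidablePred (· ∈ OrderDual.ofDual c)] (hm : 0 < ∑ a ∈ principalUp c, bernoulliWeightDual p a) :
    (fun a => (if c ≤ a then bernoulliWeightDual p a else 0) / ∑ a ∈ principalUp c, bernoulliWeightDual p a) =
      bernoulliWeightDual (fun e => if e ∈ OrderDual.ofDual c then p e else 0) := by
  funext a
  rw [sum_principalUp_bernoulliWeightDual] at hm ⊢
  rw [ite_le_bernoulliWeightDual_eq p c a, mul_div_cancel_left₀ _ hm.ne']

/-- **`C_K` for the dual product weights gives the padded `C_n`, every `n` (decreasing side).**  If every dual
product weight on `(Set ι)ᵒᵈ` is Sahi positive of order `K`, then for every `p`, every `n` and every nonnegative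
family `f_0,…,f_{n-1}` of monotone functions on `(Set ι)ᵒᵈ` (= ANTItone functions of the configuration) all but
at most `K` of which are cumulations of the dual lattice (nonnegative combinations of `1_{ω ⊆ C}`), `E_n(f) ≥ 0`.
[cite: Sahi2008, Thm. 2 (p. 211), eq. (2) (p. 210); Blinovsky2013, eq. (ee3); LiebSahi2021, p. 3 and
footnote 2; Kahn2022, Conj. 5 (arXiv p. 3)] -/
theorem sahiE_bernoulliWeightDual_nonneg_offK [DecidableEq (Set ι)ᵒᵈ] [DecidableLE (Set ι)ᵒᵈ] (K : ℕ)
    (hC : ∀ p : ι → unitInterval, SahiPositive (bernoulliWeightDual p) K) (p : ι → unitInterval) {n : ℕ}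
    (f : Fin n → (Set ι)ᵒᵈ → ℝ) (hf0 : ∀ i x, 0 ≤ f i x) (hfm : ∀ i, Monotone (f i)) (I : Finset (Fin n))
    (hI : I.card ≤ K) (hcum : ∀ i, i ∉ I → IsLatticeCumulation (f i)) :
    0 ≤ sahiE (bernoulliWeightDual p) n f := by
  classical
  refine sahiE_nonneg_offK_of_condClosed (fun μ => ∃ q : ι → unitInterval, μ = bernoulliWeightDual q) K
    ?_ ?_ ?_ ⟨p, rfl⟩ f hf0 hfm I hI hcum
  · rintro μ ⟨q, rfl⟩
    exact isFKGMeasure_bernoulliWeightDual q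
  · rintro μ ⟨q, rfl⟩ c hm
    exact ⟨_, bernoulliWeightDual_cond_principalUp q c hm⟩
  · rintro μ ⟨q, rfl⟩
    exact hC q

/-- The indicator of the "closed cylinder" event `{ω | ω ⊆ C}` ("all coordinates outside `C` are `0`"), read on
the order dual, is the indicator of a principal up-set of `(Set ι)ᵒᵈ`, hence a cumulation there.
[cite: Sahi2008, p. 210 (the class 𝒞[X]); LiebSahi2021, footnote 2 (order reversal)] -/
theorem isLatticeCumulation_ind_subsetCylinder [DecidableEq (Set ι)ᵒᵈ] [DecidableLE (Set ι)ᵒᵈ] (C : Set ι) :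
    IsLatticeCumulation (fun a : (Set ι)ᵒᵈ => ind {ω : Set ι | ω ⊆ C} (OrderDual.ofDual a)) := by
  have h : (fun a : (Set ι)ᵒᵈ => ind {ω : Set ι | ω ⊆ C} (OrderDual.ofDual a)) =
      setInd (principalUp (OrderDual.toDual C)) := by
    funext a
    rw [setInd_apply]
    have hiff : a ∈ principalUp (OrderDual.toDual C) ↔ OrderDual.ofDual a ⊆ C := mem_principalUp
    by_cases ha : OrderDual.ofDual a ⊆ C
    · rw [ind_of_mem (show OrderDual.ofDual a ∈ {ω : Set ι | ω ⊆ C} from ha), if_pos (hiff.2 ha)]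
    · rw [ind_of_not_mem (show OrderDual.ofDual a ∉ {ω : Set ι | ω ⊆ C} from ha),
        if_neg (fun h => ha (hiff.1 h))]
  rw [h]
  exact isLatticeCumulation_setInd_principalUp _

/-- **Event form, decreasing side.**  Assuming order-`K` Sahi positivity of all dual product weights on `(Set ι)ᵒᵈ`:
for events `A_0,…,A_{n-1} ⊆ 2^ι` such that the `A_i`, `i ∈ I` (`|I| ≤ K`) are DEcreasing and the others are closed
cylinders `{ω | ω ⊆ C_i}`, `E_n(1_{A_0},…,1_{A_{n-1}}) ≥ 0` under every product weight (stated for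
`bernoulliWeight p` itself: the dual is definitionally the same sum). [cite: Sahi2008, Thm. 2 (p. 211);
LiebSahi2021, p. 3 and footnote 2; Kahn2022, Conj. 5 (arXiv p. 3)] -/
theorem sahiE_bernoulliWeight_ind_nonneg_offK_lower (K : ℕ)
    (hC : ∀ p : ι → unitInterval, SahiPositive (bernoulliWeightDual p) K) (p : ι → unitInterval) {n : ℕ}
    (A : Fin n → Set (Set ι)) (I : Finset (Fin n)) (hI : I.card ≤ K) (hA : ∀ i, i ∈ I → IsLowerSet (A i))
    (C : Fin n → Set ι) (hS : ∀ i, i ∉ I → A i = {ω | ω ⊆ C i}) :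
    0 ≤ sahiE (bernoulliWeight p) n (fun i => ind (A i)) := by
  classical
  have h := sahiE_bernoulliWeightDual_nonneg_offK K hC p (fun i (a : (Set ι)ᵒᵈ) => ind (A i) (OrderDual.ofDual a))
    (fun i a => ind_nonneg _ _) (fun i => ?_) I hI ?_
  · exact h
  · by_cases hi : i ∈ I
    · exact monotone_ind_toDual_of_isLowerSet (hA i hi)
    · rw [hS i hi]
      exact monotone_ind_toDual_of_isLowerSet fun ω ω' hle (hω : ω ⊆ C i) => hle.trans hω
  · intro i hi
    rw [hS i hi]
    exact isLatticeCumulation_ind_subsetCylinder (C i)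

/-- **Unconditional case `K = 2`, decreasing side:** for a product measure on `2^ι`, two arbitrary decreasing
events and any closed cylinders `{ω | ω ⊆ C_j}`, `E_n ≥ 0` (placement `I`, `|I| ≤ 2`, of the two free slots).
[cite: Blinovsky2013, eq. (ee3); Sahi2008, Thm. 2 (p. 211); LiebSahi2021, footnote 2; Harris1960] -/
theorem sahiE_bernoulliWeight_ind_nonneg_offTwo_lower (p : ι → unitInterval) {n : ℕ}
    (A : Fin n → Set (Set ι)) (I : Finset (Fin n)) (hI : I.card ≤ 2) (hA : ∀ i, i ∈ I → IsLowerSet (A i))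
    (C : Fin n → Set ι) (hS : ∀ i, i ∉ I → A i = {ω | ω ⊆ C i}) :
    0 ≤ sahiE (bernoulliWeight p) n (fun i => ind (A i)) :=
  sahiE_bernoulliWeight_ind_nonneg_offK_lower 2
    (fun q => sahiPositive_two (isFKGMeasure_bernoulliWeightDual q)) p A I hI hA C hS

/-- **`E_4 ≥ 0` for two decreasing events and two closed cylinders under a product measure** (measure form):
`E_4(A, B, {ω ⊆ C}, {ω ⊆ D}) ≥ 0` for decreasing `A, B ⊆ 2^ι` (e.g. percolation separation events) and any
`C, D ⊆ ι` (e.g. "all edges of `S` closed" with `C = Sᶜ`), `μ = prodBernoulli p`. [cite: Blinovsky2013, eq. (ee3);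
Sahi2008, Thm. 2 (p. 211); LiebSahi2021, Def. 3.1 and footnote 2] -/
theorem sahiE4_prodBernoulli_nonneg_of_subsetCylinders (p : ι → unitInterval) {A B : Set (Set ι)}
    (hA : IsLowerSet A) (hB : IsLowerSet B) (C D : Set ι) :
    0 ≤ sahiE4 (prodBernoulli p) A B {ω | ω ⊆ C} {ω | ω ⊆ D} := by
  rw [← sahiE_four_ind]
  have h := sahiE_bernoulliWeight_ind_nonneg_offTwo_lower p ![A, B, {ω | ω ⊆ C}, {ω | ω ⊆ D}] {0, 1}
    Finset.card_le_two ?_ ![∅, ∅, C, D] ?_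
  · convert h using 2
    funext i
    fin_cases i <;> rfl
  · intro i hi
    simp only [Finset.mem_insert, Finset.mem_singleton] at hi
    rcases hi with rfl | rfl
    · exact hA
    · exact hB
  · intro i hi
    fin_cases i
    · exact absurd (by simp) hi
    · exact absurd (by simp) hi
    · rfl
    · rfl

end ProductDual

end Literature.Combinatorics.Sahi2008
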